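import Literature.NumberTheory.Sieve.LinearEquationsInPrimesEnvelopingSieveFacts
import Literature.NumberTheory.Sieve.SmoothMajorantFinal
import Literature.NumberTheory.Sieve.LinearEquationsInPrimesGvN
import HarnessLib

/-!
# The linear forms display (D.8) for the enveloping sieve, proved from the smooth Goldston–Yıldırım engine

Trunk T-SIEVE (`Literature/NumberTheory/Sieve`). Part of the App. D layer of the decomposition of
`Literature.NumberTheory.Sieve.GreenTaoZiegler2012_finiteComplexity`. This file DISCHARGES the named
fact `Literature.NumberTheory.Sieve.GreenTao2010_envelopingSieve_linearForms` of
`LinearEquationsInPrimesEnvelopingSieveFacts.lean` — B. Green, T. Tao, *Linear equations in primes*,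
Ann. of Math. 171 (2010), App. D, proof of Prop. 6.4, display (D.8):

> "we thus reduce to showing that
> `(φ(W)/W)^m ∑_{n ∈ K ∩ ℤ^d} ∏_{j ∈ [m]} Λ_{χ,R,2}(ψ_j(Wn + b_{i_j})) = vol_d(K) + o(N^d)` …
> Applying Theorem D.3 … we can thus write the left-hand side of (D.8) as
> `(φ(W)/W)^m c_{χ,2}^m vol_d(K) ∏_p β_p + o(N^d)`. … if `p ≤ w` … `β_p = (p/(p-1))^m`, and so
> `∏_{p ≤ w} β_p = (W/φ(W))^m`; if `p > w` … `β_p = 1 + O_D(p^{-2})`, so `∏_{p>w} β_p = 1 + o(1)`"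

(`theorem GreenTao2010_envelopingSieve_linearForms_holds`), so that after this file the
Green–Tao–Ziegler theorem rests, in this tree, on the correlation display
`GreenTao2010_envelopingSieve_correlations` (the other consequence of Thm. D.3 used in App. D) and
on the Gowers uniformity estimate Thm. 7.2 (`GreenTao2010_gowersUniformity`) alone
(`LinearEquationsInPrimesEnvelopingSieveDomination.lean`).

## The proof as formalised

The Goldston–Yıldırım computation behind Thm. D.3 in the linear forms regime is the tree's PROVED
smooth linear forms estimate of D. Conlon, J. Fox, Y. Zhao, *The Green–Tao theorem: an exposition*,
EMS Surv. Math. Sci. 1 (2014), Prop. 8.3 and §9 (files `SmoothMajorant*.lean`; the fixed-parameter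
engine `Literature.NumberTheory.Sieve.CFZ.Setup.abs_expect_div_sub_one_le`): for a real level `R ≥ e`,
`W = ∏_{p ≤ w} p` with `w ≥ 21m + 2`, `w ≥ 2C₀²`, integer systems with `|L_{ij}| ≤ C₀`, nonzero
pairwise non-proportional rows and ARBITRARY integer shifts, and boxes of sides `≥ R^{10m}`,
`|E_{x∈B} ∏_i Λ_{χ,R}(W(∑_j L_{ij}x_j + b_i) + 1)² / (c_χ W log R/φ(W))^m - 1| ≤ fixedErr(R, T, w)`,
with `Λ_{χ,R}² = log R · Λ_{χ,R,2}` (`truncDivisorSum_two_eq`). We use it as follows.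

* Signed cutoffs (`abs_expect_div_sub_one_le_signed`): the engine's cutoff class asks
  `0 ≤ χ ≤ 1`, but its proof uses only smoothness, `supp χ ⊆ [-1,1]` and `|χ| ≤ 1`; Thm. D.3 is
  stated for signed smooth compactly supported `χ` (`IsSmoothCompactCutoff`), reduced to `|χ| ≤ 1`
  by scaling (`truncDivisorSum_two_smul`, `cChi_smul`: both sides of (D.8) scale by `s^{2m}`), and
  degenerate cutoffs `c_χ = 0` vanish on `[0, ∞)` (`cChi_pos_of_ne_zero`,
  `truncDivisorSum_eq_zero_of_cChi_eq_zero`), where (D.8) reads `0 = 0`.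
* The residues `b_j` (`exists_shift`, `truncDivisorSum_shift`): the forms of (D.8) are
  `Wψ_j(n) + b_j` with `b_j ∈ [W]` coprime to `W`, the engine's are `W(·) + 1`. For
  `M = ∏_{w < p ≤ R} p` (`midPrimorial`) and `k_j` with `W k_j + 1 ≡ b_j (mod M)` (`W` is invertible
  modulo `M`), `Λ_{χ,R,a}(Wψ + b_j) = Λ_{χ,R,a}(W(ψ + k_j) + 1)` identically: only square-free
  `e ≤ R` enter, those with a prime factor `≤ w` divide neither number, the others divide `M`
  (`moebiusDivisorSum_eq_of_dvd_sub`). So the engine applies with the shift `ψ_j(0) + k_j`.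
* Range-uniform cutoff (`fixedErr_le_uniform`, `box_estimate`): the engine's asymptotics are
  packaged in the tree along `R = N^{k⁻¹2^{-k-4}}`, `w = w(N) ≤ (log R)^{1/8}`; here
  `R = N^γ` and `w₀ ≤ w ≤ ½ log log N` is range-uniform, so the smallness of `fixedErr` is redone in
  the variable `K = log R → ∞` uniformly in `w ∈ [w₀, K^{1/8}]` (`T = K^{1/2}`, `A = 8m + 2`, the
  master quantity `s(K) = δ K^{1/4}` of the tree, `β ≤ exp(288 m s e^{144ms}) - 1`,
  `γ_err ≤ e^{δ_m/w₀} - 1`), and `½ log log N ≤ (γ log N)^{1/8}` eventually (`exists_loglog_le`).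
* From boxes to convex bodies (`cell_sandwich`, `cell_mass`, `linearForms_of_abs_le_one`): with
  `γ ≤ γ₀ = 1/(20D+20)` and `ρ = ⌊√N⌋ + 1 ≥ R^{10m}`, cut `ℤ^d` into the cubes `mρ + [0,ρ)^d`
  (`cellPts`); the cubes whose closed box lies in `K` are full and carry mass
  `(1 ± ε') ρ^d c_χ^m (W/φ(W))^m` by the engine; the cubes whose box meets `K` without lying in it
  number `O_d((N/ρ)^{d-1})` (the tree's `card_boundaryCells_le`, App. A) and, `Λ_{χ,R,2}` being
  NON-NEGATIVE, contribute between `0` and a full mass; the number of full cubes is compared with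
  `vol_d(K)` through `#(K ∩ ℤ^d) = vol_d(K) + O_d(N^{d-1})` (the tree's
  `LatticePointsConvexBody.abs_card_sub_volume_le`, App. A). The resulting error is
  `ε' c_χ^m vol(K) + O_{D,χ}(N^{d-1/2}) ≤ ε N^d`.

Everything is proved; the thresholds `w₀, N₀` are uniform in `d, m ≤ D`, the residues, the system
(`‖Ψ‖_N ≤ L`, Def. 1.1 non-degeneracy and finite complexity give the engine's hypotheses,
`not_rat_proportional`) and the convex body, as the named fact demands.

## References

* B. Green, T. Tao, *Linear equations in primes*, Ann. of Math. (2) 171 (2010), 1753–1850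
  (arXiv:math/0606088): App. D, Thm. D.3 and the proof of Prop. 6.4 (display (D.8) and the two
  paragraphs following it), App. A (lattice points of convex bodies). [cite: GreenTao2010]
* D. Conlon, J. Fox, Y. Zhao, *The Green–Tao theorem: an exposition*, EMS Surv. Math. Sci. 1 (2014),
  249–282: Prop. 8.3 and §9 (the smooth linear forms estimate; the engine of this file).
  [cite: ConlonFoxZhao2014]
* B. Green, T. Tao, *The primes contain arbitrarily long arithmetic progressions*, Ann. of Math. (2)
  167 (2008), Prop. 9.5 and the proof of Prop. 9.8 (boxes and boundary boxes), for comparison.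
-/

noncomputable section

open Finset MeasureTheory Filter Topology
open scoped BigOperators

namespace Literature.NumberTheory.Sieve

namespace EnvelopingSieveGY

/-! ### The residue trick: `Λ_{χ,R,2}(Wψ + b) = Λ_{χ,R,2}(W(ψ + k) + 1)` -/

/-- The product of the primes in `(w, n]`. [folklore] -/
def midPrimorial (w n : ℕ) : ℕ := ∏ p ∈ (range (n + 1)).filter (fun p => p.Prime ∧ w < p), p

/-- `∏_{w < p ≤ n} p` is coprime to `W = ∏_{p ≤ w} p`. [folklore] -/
theorem coprime_primorial_midPrimorial (w n : ℕ) : Nat.Coprime (primorial w) (midPrimorial w n) := by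
  unfold primorial midPrimorial
  refine Nat.Coprime.prod_left fun p hp => Nat.Coprime.prod_right fun q hq => ?_
  have hp' := (mem_filter.1 hp); have hq' := (mem_filter.1 hq)
  have hpw : p ≤ w := by have := mem_range.1 hp'.1; omega
  exact (Nat.coprime_primes hp'.2 hq'.2.1).2 (by rintro rfl; omega)

/-- A square-free `e ≤ n` all of whose prime factors exceed `w` divides `∏_{w < p ≤ n} p`. [folklore] -/
theorem dvd_midPrimorial_of_squarefree {w n e : ℕ} (he : Squarefree e) (hen : e ≤ n)
    (hw : ∀ p ∈ e.primeFactors, w < p) : e ∣ midPrimorial w n := by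
  rw [← Nat.prod_primeFactors_of_squarefree he]
  refine Finset.prod_dvd_prod_of_subset _ _ _ fun p hp => ?_
  have hp' := Nat.mem_primeFactors.1 hp
  refine mem_filter.2 ⟨mem_range.2 ?_, hp'.1, hw p hp⟩
  have : p ≤ e := Nat.le_of_dvd (Nat.pos_of_ne_zero he.ne_zero) hp'.2.1
  omega

/-- **The residue trick.** If `y ≡ y'` modulo `∏_{w < p ≤ R} p` and neither `y` nor `y'` has a
prime factor `≤ w`, then the smoothly truncated Möbius sums of `y` and `y'` at level `R` agree:
only square-free `e ≤ R` contribute, those with a prime factor `≤ w` divide neither number, and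
the others divide `∏_{w < p ≤ R} p`. [folklore] -/
theorem moebiusDivisorSum_eq_of_dvd_sub (χ : ℝ → ℝ) (R : ℝ) {w : ℕ} {y y' : ℤ}
    (hyy' : (midPrimorial w ⌊R⌋₊ : ℤ) ∣ y' - y)
    (hy : ∀ p : ℕ, p.Prime → p ≤ w → ¬ (p : ℤ) ∣ y) (hy' : ∀ p : ℕ, p.Prime → p ≤ w → ¬ (p : ℤ) ∣ y') :
    moebiusDivisorSum χ R y = moebiusDivisorSum χ R y' := by
  unfold moebiusDivisorSum
  rw [Finset.sum_filter, Finset.sum_filter]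
  refine Finset.sum_congr rfl fun e he => ?_
  by_cases hsq : Squarefree e
  · have hiff : (e : ℤ) ∣ y ↔ (e : ℤ) ∣ y' := by
      by_cases hsmall : ∃ p ∈ e.primeFactors, p ≤ w
      · obtain ⟨p, hp, hpw⟩ := hsmall
        have hp' := Nat.mem_primeFactors.1 hp
        have hpe : (p : ℤ) ∣ (e : ℤ) := Int.natCast_dvd_natCast.2 hp'.2.1
        exact ⟨fun h => absurd (hpe.trans h) (hy p hp'.1 hpw), fun h => absurd (hpe.trans h) (hy' p hp'.1 hpw)⟩
      · push Not at hsmall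
        have hdvd : (e : ℤ) ∣ y' - y :=
          (Int.natCast_dvd_natCast.2 (dvd_midPrimorial_of_squarefree hsq (mem_Icc.1 he).2 hsmall)).trans hyy'
        constructor
        · intro h; have := dvd_add h hdvd; rwa [add_sub_cancel] at this
        · intro h; have := dvd_sub h hdvd; rwa [sub_sub_cancel] at this
    simp only [hiff]
  · simp [ArithmeticFunction.moebius_eq_zero_of_not_squarefree hsq]

/-- The shift `k` with `W k + 1 ≡ b` modulo `∏_{w < p ≤ n} p` (`W` is invertible modulo it). [folklore] -/
theorem exists_shift (w n : ℕ) (b : ℤ) : ∃ k : ℤ, (midPrimorial w n : ℤ) ∣ (primorial w : ℤ) * k + 1 - b := by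
  obtain ⟨u, v, huv⟩ := (Nat.isCoprime_iff_coprime.2 (coprime_primorial_midPrimorial w n))
  refine ⟨u * (b - 1), ⟨-(v * (b - 1)), ?_⟩⟩
  linear_combination (b - 1) * huv

/-- `W z + b` has no prime factor `p ≤ w` when `b` is coprime to `W = ∏_{p ≤ w} p`. [folklore] -/
theorem not_dvd_of_coprime {w : ℕ} {b : ℕ} (hb : Nat.Coprime b (primorial w)) {p : ℕ} (hp : p.Prime)
    (hpw : p ≤ w) (z : ℤ) : ¬ (p : ℤ) ∣ (primorial w : ℤ) * z + b := by
  have hpW : p ∣ primorial w := (hp.dvd_primorial_iff).2 hpw  -- check name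
  intro h
  have h1 : (p : ℤ) ∣ (primorial w : ℤ) * z := (Int.natCast_dvd_natCast.2 hpW).mul_right z
  have h2 : (p : ℤ) ∣ (b : ℤ) := by have := dvd_sub h h1; rwa [add_sub_cancel_left] at this
  have h3 : p ∣ b := Int.natCast_dvd_natCast.1 h2
  have : p ∣ Nat.gcd b (primorial w) := Nat.dvd_gcd h3 hpW
  rw [hb] at this
  exact hp.one_lt.ne' (Nat.dvd_one.1 this)

/-- **`Λ_{χ,R,a}(Wψ + b) = Λ_{χ,R,a}(W(ψ + k) + 1)`** for the shift `k` of `exists_shift`. [folklore] -/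
theorem truncDivisorSum_shift (χ : ℝ → ℝ) (R : ℝ) (a : ℕ) {w : ℕ} {b : ℕ} (hb : Nat.Coprime b (primorial w))
    {k : ℤ} (hk : (midPrimorial w ⌊R⌋₊ : ℤ) ∣ (primorial w : ℤ) * k + 1 - b) (z : ℤ) :
    truncDivisorSum χ R a ((primorial w : ℤ) * z + b) =
      truncDivisorSum χ R a ((primorial w : ℤ) * (z + k) + 1) := by
  unfold truncDivisorSum
  rw [moebiusDivisorSum_eq_of_dvd_sub χ R (w := w) (y' := (primorial w : ℤ) * (z + k) + 1) ?_ ?_ ?_]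
  · have : (primorial w : ℤ) * (z + k) + 1 - ((primorial w : ℤ) * z + b) = (primorial w : ℤ) * k + 1 - b := by ring
    rwa [this]
  · exact fun p hp hpw => not_dvd_of_coprime hb hp hpw z
  · intro p hp hpw
    have := not_dvd_of_coprime (b := 1) (Nat.coprime_one_left _) hp hpw (z + k)
    simpa using this

/-! ### Scaling the cutoff -/

/-- `∑_{e ∣ n} μ(e) (sχ)(log e/log R) = s ∑_{e ∣ n} μ(e) χ(log e/log R)`. [folklore] -/
theorem moebiusDivisorSum_smul (s : ℝ) (χ : ℝ → ℝ) (R : ℝ) (n : ℤ) :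
    moebiusDivisorSum (fun x => s * χ x) R n = s * moebiusDivisorSum χ R n := by
  unfold moebiusDivisorSum
  rw [Finset.mul_sum]
  exact Finset.sum_congr rfl fun e _ => by ring

/-- `Λ_{sχ,R,2} = s² Λ_{χ,R,2}`. [folklore] -/
theorem truncDivisorSum_two_smul (s : ℝ) (χ : ℝ → ℝ) (R : ℝ) (n : ℤ) :
    truncDivisorSum (fun x => s * χ x) R 2 n = s ^ 2 * truncDivisorSum χ R 2 n := by
  unfold truncDivisorSum
  rw [moebiusDivisorSum_smul]
  ring

/-- `c_{sχ} = s² c_χ`. [folklore] -/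
theorem cChi_smul (s : ℝ) (χ : ℝ → ℝ) : GreenTao2008.cChi (fun x => s * χ x) = s ^ 2 * GreenTao2008.cChi χ := by
  unfold GreenTao2008.cChi
  rw [← integral_const_mul]
  refine integral_congr_ae (Eventually.of_forall fun x => ?_)
  simp only [deriv_const_mul_field', mul_pow]

/-- A smooth compactly supported cutoff is bounded: `|χ| ≤ s` for some `s ≥ 1`. [folklore] -/
theorem exists_bound_cutoff {χ : ℝ → ℝ} (hχ : IsSmoothCompactCutoff χ) : ∃ s : ℝ, 1 ≤ s ∧ ∀ x, |χ x| ≤ s := by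
  obtain ⟨C, hC⟩ := (isCompact_Icc (a := (-1 : ℝ)) (b := 1)).exists_bound_of_continuousOn
    (hχ.contDiff.continuous.continuousOn)
  refine ⟨max C 1, le_max_right _ _, fun x => ?_⟩
  by_cases hx : x ∈ Set.Icc (-1 : ℝ) 1
  · exact ((Real.norm_eq_abs _).symm.le.trans (hC x hx)).trans (le_max_left _ _)
  · have : χ x = 0 := by
      by_contra h
      exact hx (hχ.2 (Function.mem_support.2 h))
    rw [this, abs_zero]; positivity

/-- Scaling preserves the cutoff class. [folklore] -/
theorem isSmoothCompactCutoff_smul (s : ℝ) {χ : ℝ → ℝ} (hχ : IsSmoothCompactCutoff χ) :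
    IsSmoothCompactCutoff (fun x => s * χ x) := by
  refine ⟨contDiff_const.mul hχ.1, fun x hx => hχ.2 ?_⟩
  rw [Function.mem_support] at hx ⊢
  exact fun h => hx (by rw [h, mul_zero])

/-! ### Degenerate cutoffs: `c_χ = 0` forces `χ = 0` on `[0, ∞)` -/

/-- If `χ(x₀) ≠ 0` for some `x₀ ≥ 0` then `c_χ = ∫₀^∞ χ'² > 0` (mean value theorem between `x₀`
and `2`, where `χ` vanishes, and continuity of `χ'`). [folklore] -/
theorem cChi_pos_of_ne_zero {χ : ℝ → ℝ} (hχ : IsSmoothCompactCutoff χ) {x₀ : ℝ} (hx₀ : 0 ≤ x₀)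
    (hne : χ x₀ ≠ 0) : 0 < GreenTao2008.cChi χ := by
  have hcd : ContDiff ℝ 1 χ := hχ.contDiff.of_le (mod_cast le_top)
  have hdiff : Differentiable ℝ χ := hcd.differentiable one_ne_zero
  have hcont' : Continuous (deriv χ) := hcd.continuous_deriv le_rfl
  have hzero : ∀ x, 1 ≤ |x| → χ x = 0 := hχ.eq_zero_of_one_le_abs
  have hx2 : x₀ < 2 := by
    by_contra h
    exact hne (hzero x₀ (by rw [abs_of_nonneg hx₀]; linarith))
  obtain ⟨ξ, hξ, hξ'⟩ := exists_deriv_eq_slope χ hx2 hdiff.continuous.continuousOn hdiff.differentiableOn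
  have hχ2 : χ 2 = 0 := hzero 2 (by norm_num)
  have hξne : deriv χ ξ ≠ 0 := by
    rw [hξ', hχ2]
    intro h
    rw [div_eq_zero_iff] at h
    rcases h with h | h
    · exact hne (by linarith)
    · linarith
  have hξpos : 0 < ξ := lt_of_le_of_lt hx₀ hξ.1
  set f : ℝ → ℝ := fun x => deriv χ x ^ 2 with hf
  have hfcont : Continuous f := hcont'.pow 2
  have hf0 : ∀ x, 0 ≤ f x := fun x => sq_nonneg _
  have hsupp : ∀ x, 1 < |x| → deriv χ x = 0 := by
    intro x hx
    have hev : χ =ᶠ[𝓝 x] fun _ => 0 := by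
      have hopen : IsOpen {y : ℝ | 1 < |y|} := isOpen_lt continuous_const continuous_abs
      filter_upwards [hopen.mem_nhds hx] with y hy
      exact hzero y hy.le
    rw [hev.deriv_eq]
    exact deriv_const x 0
  have hcs : HasCompactSupport f := by
    refine HasCompactSupport.intro (isCompact_Icc (a := (-1 : ℝ)) (b := 1)) fun x hx => ?_
    have : 1 < |x| := by
      rw [Set.mem_Icc, not_and_or, not_le, not_le] at hx
      rcases hx with h | h
      · rw [abs_of_neg (by linarith)]; linarith
      · rw [abs_of_pos (by linarith)]; linarith
    simp [hf, hsupp x this]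
  have hint : Integrable f := hfcont.integrable_of_hasCompactSupport hcs
  unfold GreenTao2008.cChi
  change 0 < ∫ x in Set.Ioi (0 : ℝ), f x
  rw [setIntegral_pos_iff_support_of_nonneg_ae (Eventually.of_forall hf0) hint.integrableOn]
  have hfξ : 0 < f ξ := by simp only [hf]; positivity
  obtain ⟨δ, hδ, hball⟩ : ∃ δ > 0, ∀ y, dist y ξ < δ → 0 < f y := by
    have hev := hfcont.continuousAt.eventually (lt_mem_nhds hfξ)
    exact Metric.eventually_nhds_iff.1 hev
  have hsub : Set.Ioo ξ (ξ + δ) ⊆ Function.support f ∩ Set.Ioi 0 := by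
    intro y hy
    refine ⟨(hball y ?_).ne', ?_⟩
    · rw [Real.dist_eq, abs_of_nonneg (by linarith [hy.1])]; linarith [hy.2]
    · exact lt_trans hξpos hy.1
  calc (0 : ENNReal) < volume (Set.Ioo ξ (ξ + δ)) := by
        rw [Real.volume_Ioo]; simp [hδ]
    _ ≤ volume (Function.support f ∩ Set.Ioi 0) := measure_mono hsub

/-- For a degenerate cutoff (`c_χ = 0`), `χ = 0` on `[0, ∞)`, so every `Λ_{χ,R,a}` with `R ≥ 1`,
`a ≥ 1` vanishes identically. [folklore] -/
theorem truncDivisorSum_eq_zero_of_cChi_eq_zero {χ : ℝ → ℝ} (hχ : IsSmoothCompactCutoff χ)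
    (hc : GreenTao2008.cChi χ = 0) {R : ℝ} (hR : 1 ≤ R) {a : ℕ} (ha : 1 ≤ a) (n : ℤ) :
    truncDivisorSum χ R a n = 0 := by
  have hzero : ∀ x, 0 ≤ x → χ x = 0 := by
    intro x hx
    by_contra h
    exact (cChi_pos_of_ne_zero hχ hx h).ne' hc
  unfold truncDivisorSum moebiusDivisorSum
  have : ∀ e ∈ (Icc 1 ⌊R⌋₊).filter (fun e : ℕ => (e : ℤ) ∣ n),
      (ArithmeticFunction.moebius e : ℝ) * χ (Real.log e / Real.log R) = 0 := by
    intro e he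
    have he1 : 1 ≤ e := (mem_Icc.1 (mem_filter.1 he).1).1
    rw [hzero _ (div_nonneg (Real.log_nonneg (by exact_mod_cast he1)) (Real.log_nonneg hR)), mul_zero]
  rw [Finset.sum_eq_zero this, zero_pow (by omega), mul_zero]

/-! ### Rational non-proportionality from finite complexity -/

/-- Finite complexity (no two linear parts are integer-proportional with a non-trivial relation)
and non-degeneracy (`ψ̇_i ≠ 0`) give the engine's hypothesis: no row is a rational multiple of
another. [cite: GreenTao2010, Def. 1.5 and Cor. 1.7] -/
theorem not_rat_proportional {d t : ℕ} {Ψ : Fin t → AffLinForm d} (hfc : IsFiniteComplexitySystem Ψ)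
    (i i' : Fin t) (hii' : i ≠ i') (c : ℚ) :
    (fun j => ((Ψ i).coeff j : ℚ)) ≠ c • fun j => ((Ψ i').coeff j : ℚ) := by
  intro h
  have hden : (c.den : ℤ) ≠ 0 := by exact_mod_cast c.den_nz
  have key : (c.den : ℤ) • (Ψ i).coeff = c.num • (Ψ i').coeff := by
    funext j
    have hj := congr_fun h j
    simp only [Pi.smul_apply, smul_eq_mul] at hj ⊢
    have : ((c.den : ℤ) : ℚ) * ((Ψ i).coeff j : ℚ) = (c.num : ℚ) * ((Ψ i').coeff j : ℚ) := by
      rw [hj, ← mul_assoc]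
      congr 1
      rw [mul_comm]
      exact (Rat.mul_den_eq_num c)
    exact_mod_cast this
  exact hden (hfc i i' hii' _ _ key).1


/-! ### The smooth Goldston–Yıldırım engine for signed cutoffs -/

section Engine

open Literature.NumberTheory.Sieve.CFZ Literature.NumberTheory.Sieve.GreenTao2008
open scoped Real

variable {m n : ℕ} {R : ℝ} {w C₀ : ℕ} {L : Fin m → Fin (n + 1) → ℤ} {χ : ℝ → ℝ}

/-- **The estimate at fixed parameters for a signed cutoff** `|χ| ≤ 1`: the tree's
`CFZ.Setup.abs_expect_div_sub_one_le` verbatim, its hypothesis `IsSmoothCutoff χ` (which also asks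
`0 ≤ χ ≤ 1`) being used there only through smoothness, the support condition and `|χ| ≤ 1`.
[cite: ConlonFoxZhao2014, Section 9, equations (28)–(38)] [cite: GreenTao2010, App. D, Thm. D.3] -/
theorem abs_expect_div_sub_one_le_signed (S : Setup m n R w C₀ L) (hs : ContDiff ℝ (⊤ : ℕ∞) χ)
    (hsupp : ∀ x, 1 ≤ |x| → χ x = 0) (hχ1 : ∀ x, |χ x| ≤ 1) (hcχ : 0 < cChi χ)
    {T δ₀ K₀ : ℝ} (hT : 1 ≤ T) (hK₀ : 0 ≤ K₀)
    (hζ : ∀ z z' : ℂ, z ≠ 0 → z' ≠ 0 → z + z' ≠ 0 → ∀ δ : ℝ, δ ≤ δ₀ → ‖z‖ ≤ δ → ‖z'‖ ≤ δ →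
      ‖riemannZeta (1 + z + z') / (riemannZeta (1 + z) * riemannZeta (1 + z')) - z * z' / (z + z')‖ ≤
        K₀ * δ * ‖z * z' / (z + z')‖)
    (hδ₀ : deltaOf R T ≤ δ₀) (hδw : 2 * deltaOf R T * Real.log w ≤ 1 / 8)
    (hβ : betaErr (deltaOf R T) m w ≤ 1 / 2) {CB : ℝ} (hCB0 : 0 ≤ CB)
    (hCB : ∀ (b : Fin m → ℤ) (Q : ℕ) (η : Fin m ⊕ Fin m → ℝ),
      ‖∏ p ∈ Q.primesBelow, eulerFactor p (primorial w) L b (zL R η) (zR R η)‖ ≤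
        (Real.log R + CB) ^ (3 * m) * Real.exp (2 * 4 ^ m))
    (A : ℕ) (b : Fin m → ℤ) (a : Fin (n + 1) → ℤ) (ℓ : Fin (n + 1) → ℕ) (hℓ : ∀ j, R ^ (10 * m) ≤ ℓ j) :
    |(𝔼 x ∈ Fintype.piFinset (fun j => Ico (a j) (a j + ℓ j)),
        ∏ i, smoothDivisorSum χ R (primorial w * (∑ j, L i j * x j + b i) + 1) ^ 2) /
        (cChi χ * (primorial w : ℝ) * Real.log R / Nat.totient (primorial w)) ^ m - 1| ≤
      fixedErr χ m n A K₀ CB R T w := by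
  have hR1 := S.one_lt
  have hK := S.log_pos
  set K := Real.log R with hK_def
  set c := cW w m with hc_def
  set B := (K + CB) ^ (3 * m) * Real.exp (2 * 4 ^ m) with hB_def
  set κ := ((2 * K) ^ m)⁻¹ with hκ_def
  set M₂ := ∫ x, phiWeight χ x with hM₂_def
  set τ := (2 * m : ℕ) * ((T ^ A)⁻¹ * weightMoment χ A) * M₂ ^ (2 * m - 1) with hτ_def
  set Et := totErr K₀ (deltaOf R T) m w with hEt_def
  have hc1 : 1 ≤ c := one_le_cW w m
  have hM₂0 : 0 ≤ M₂ := integral_nonneg (phiWeight_nonneg χ)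
  have hEt0 : 0 ≤ Et := totErr_nonneg hK₀ (deltaOf_nonneg (by linarith) hK) m w
  have hB0 : 0 ≤ B := by positivity
  have hτ0 : 0 ≤ τ := by
    have := weightMoment_nonneg χ A
    positivity
  -- Step 1: the expectation is `K^{2m} (S + E₃)`
  have hℓ' : ∀ j, R ^ (2 * m) ≤ ℓ j := fun j => (pow_le_pow_right₀ hR1.le (by omega)).trans (hℓ j)
  obtain ⟨E₃, hE₃, hexp⟩ := exists_expect_eq hχ1 hR1.le (primorial w) L b a ℓ hℓ'
  have hE' : |E₃| ≤ R ^ (2 * m) * ((n + 1 : ℕ) * (R ^ (2 * m) / R ^ (10 * m))) := by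
    refine hE₃.trans (mul_le_mul_of_nonneg_left ?_ (by positivity))
    have hR10 : 0 < R ^ (10 * m) := by positivity
    calc ∑ j, R ^ (2 * m) / (ℓ j : ℝ) ≤ ∑ _j : Fin (n + 1), R ^ (2 * m) / R ^ (10 * m) :=
          sum_le_sum fun j _ => div_le_div_of_nonneg_left (by positivity) hR10 (hℓ j)
      _ = (n + 1 : ℕ) * (R ^ (2 * m) / R ^ (10 * m)) := by
          rw [sum_const, card_univ, Fintype.card_fin, nsmul_eq_mul]
  -- Step 2: `|S - c (c_χ/K)^m| ≤ ErrM`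
  have hmain := S.norm_integral_limF_sub_main_le hs hsupp b (by linarith : (0 : ℝ) ≤ T) hK₀ hζ hδ₀ hδw hβ (hCB b)
  rw [← S.trueSumC_eq_integral hs hsupp b, integral_phiF_mainZ hs hsupp hR1, ← trueSumR_cast] at hmain
  have hS : |trueSumR χ R (primorial w) L b - c * (cChi χ / K) ^ m| ≤
      Et * c * κ * M₂ ^ (2 * m) + (B + c * κ) * τ := by
    have hcast : ((trueSumR χ R (primorial w) L b : ℝ) : ℂ) -
        (c : ℂ) * ((K : ℂ)⁻¹ * ((∫ x in Set.Ioi (0 : ℝ), deriv χ x ^ 2 : ℝ) : ℂ)) ^ m =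
          ((trueSumR χ R (primorial w) L b - c * (cChi χ / K) ^ m : ℝ) : ℂ) := by
      unfold cChi
      push_cast
      ring
    rw [hcast, Complex.norm_real, Real.norm_eq_abs] at hmain
    refine hmain.trans ?_
    gcongr
    exact tailBox_le hs hsupp A hT
  -- Step 3: algebra
  rw [hexp, denom_pow_eq_mul_cW]
  refine (abs_ratio_sub_one_le hK hcχ hc1 hS hE').trans ?_
  exact fixed_algebra hK hcχ hc1 hEt0 (by positivity) hB0 hτ0 (by positivity)

/-! ### Smallness of the error, uniformly in the cutoff `w ∈ [w₀, (log R)^{1/8}]` -/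

/-- The master small quantity `s(K) = δ K^{1/4}`, `δ = (1 + 2π K^{1/2})/K`, `K = log R`. [cite: ConlonFoxZhao2014, Section 9] -/
def sOf (K : ℝ) : ℝ := (1 + 2 * π * Real.sqrt K) / K * K ^ (1 / 4 : ℝ)

/-- The uniform bound `Y(s) = exp(288 m s e^{144 m s}) - 1` for `β`. [cite: ConlonFoxZhao2014, Section 9, equation (36)] -/
def betaBar (m : ℕ) (s : ℝ) : ℝ := Real.exp (2 * s * (144 * m) * Real.exp (144 * m * s)) - 1

/-- The uniform bound `(1 + (1 + K₀ s)^m - 1)(1 + 2 Y(s)) - 1` for `(1+α)(1+2β) - 1`. [cite: ConlonFoxZhao2014, Section 9] -/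
def pBar (K₀ : ℝ) (m : ℕ) (s : ℝ) : ℝ := (1 + ((1 + K₀ * s) ^ m - 1)) * (1 + 2 * betaBar m s) - 1

/-- `s(K) → 0`. [cite: ConlonFoxZhao2014, Section 9] -/
theorem tendsto_sOf : Tendsto sOf atTop (𝓝 0) := tendsto_deltaOf_mul_rpow

/-- `Y(s) → 0` as `s → 0`. [folklore] -/
theorem tendsto_betaBar (m : ℕ) : Tendsto (betaBar m) (𝓝 0) (𝓝 0) := by
  have hc : Continuous (betaBar m) := by unfold betaBar; fun_prop
  have h := hc.tendsto 0
  simp only [betaBar, mul_zero, zero_mul, Real.exp_zero, sub_self] at h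
  exact h

/-- `P̄(s) → 0` as `s → 0`. [folklore] -/
theorem tendsto_pBar (K₀ : ℝ) (m : ℕ) : Tendsto (pBar K₀ m) (𝓝 0) (𝓝 0) := by
  have hc : Continuous (pBar K₀ m) := by unfold pBar betaBar; fun_prop
  have h := hc.tendsto 0
  simp only [pBar, betaBar, mul_zero, zero_mul, Real.exp_zero, sub_self, add_zero, one_pow, mul_one] at h
  exact h

/-- `Y(s) ≥ 0` for `s ≥ 0`. [folklore] -/
theorem betaBar_nonneg (m : ℕ) {s : ℝ} (hs : 0 ≤ s) : 0 ≤ betaBar m s := by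
  unfold betaBar
  have : 1 ≤ Real.exp (2 * s * (144 * m) * Real.exp (144 * m * s)) := Real.one_le_exp (by positivity)
  linarith

/-- **The error bound, uniformly in `w`.** For `K = log R ≥ 1`, `1 ≤ w₀ ≤ w ≤ K^{1/8}`:
`δ ≤ s(K)`, `δ log w ≤ s(K)`, `β ≤ Y(s(K))`, and
`fixedErr ≤ ((P̄(s)(1 + γ̄) + γ̄) M₂^{2m} + ((1+C_B)^{3m} e^{2·4^m} + 1) K⁻¹ · 2m M_A M₂^{2m-1} + (n+1) K⁻¹)/c_χ^m`
with `γ̄ = γ(w₀)`. [cite: ConlonFoxZhao2014, Section 9] -/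
theorem fixedErr_le_uniform (χ : ℝ → ℝ) {m n : ℕ} (hm : 1 ≤ m) {K₀ CB R : ℝ} (hK₀ : 0 ≤ K₀) (hCB : 0 ≤ CB)
    (hR : 0 < R) (hK : 1 ≤ Real.log R) {w₀ w : ℕ} (hw₀ : 1 ≤ w₀) (hw : w₀ ≤ w)
    (hwK : (w : ℝ) ≤ Real.log R ^ (1 / 8 : ℝ)) (hcχ : 0 < cChi χ) :
    deltaOf R (Real.sqrt (Real.log R)) ≤ sOf (Real.log R) ∧
    deltaOf R (Real.sqrt (Real.log R)) * Real.log w ≤ sOf (Real.log R) ∧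
    betaErr (deltaOf R (Real.sqrt (Real.log R))) m w ≤ betaBar m (sOf (Real.log R)) ∧
    fixedErr χ m n (8 * m + 2) K₀ CB R (Real.sqrt (Real.log R)) w ≤
      ((pBar K₀ m (sOf (Real.log R)) * (1 + gammaErr m w₀) + gammaErr m w₀) * (∫ x, phiWeight χ x) ^ (2 * m) +
        (((1 + CB) ^ (3 * m) * Real.exp (2 * 4 ^ m) + 1) * (Real.log R)⁻¹) *
          ((2 * m : ℕ) * weightMoment χ (8 * m + 2) * (∫ x, phiWeight χ x) ^ (2 * m - 1)) +
        ((n + 1 : ℕ) : ℝ) * (Real.log R)⁻¹) / cChi χ ^ m := by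
  set K := Real.log R with hK_def
  have hK0 : 0 < K := by linarith
  set δ := deltaOf R (Real.sqrt K) with hδ_def
  have hδ : 0 ≤ δ := deltaOf_nonneg (Real.sqrt_nonneg _) hK0
  have hw1 : 1 ≤ w := hw₀.trans hw
  obtain ⟨h1, h2, h3, h4⟩ := smallness_bounds hK hδ hw1 hwK
  have hs_def : δ * K ^ (1 / 4 : ℝ) = sOf K := rfl
  set s := sOf K with hs
  have hs0 : 0 ≤ s := by rw [← hs_def]; positivity
  -- β
  have hβ : betaErr δ m w ≤ betaBar m s := by
    refine (betaErr_le hδ m w).trans ?_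
    unfold betaBar
    have e2 : Real.exp (m * (144 * δ * w)) = Real.exp (144 * m * (δ * w)) := by congr 1; ring
    rw [e2]
    gcongr Real.exp ?_ - 1
    calc (w + 1 : ℝ) * (m * (144 * δ * w) * Real.exp (144 * m * (δ * w)))
        = 144 * m * ((w + 1) * w * δ) * Real.exp (144 * m * (δ * w)) := by ring
      _ ≤ 144 * m * (2 * s) * Real.exp (144 * m * s) := by rw [← hs_def] at *; gcongr
      _ = 2 * s * (144 * m) * Real.exp (144 * m * s) := by ring
  refine ⟨h1, h2, hβ, ?_⟩
  -- α, γ, totErr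
  have hδs : δ ≤ s := by rw [← hs_def]; exact h1
  have hα : alphaErr K₀ δ m ≤ (1 + K₀ * s) ^ m - 1 := by
    unfold alphaErr
    gcongr
  have hα0 : 0 ≤ alphaErr K₀ δ m := alphaErr_nonneg hK₀ hδ m
  have hβ0 : 0 ≤ betaErr δ m w := betaErr_nonneg hδ m w
  have hγ : gammaErr m w ≤ gammaErr m w₀ := by
    unfold gammaErr
    gcongr Real.exp ?_ - 1
    exact div_le_div_of_nonneg_left (deltaConst_nonneg m) (by exact_mod_cast hw₀) (by exact_mod_cast hw)
  have hγ0 : 0 ≤ gammaErr m w := gammaErr_nonneg m w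
  have hγ0' : 0 ≤ gammaErr m w₀ := gammaErr_nonneg m w₀
  have hP0 : alphaErr K₀ δ m ≤ (1 + K₀ * s) ^ m - 1 := hα
  have htot : totErr K₀ δ m w ≤ pBar K₀ m s * (1 + gammaErr m w₀) + gammaErr m w₀ := by
    unfold totErr pBar
    have hb' : betaErr δ m w ≤ betaBar m s := hβ
    set a := alphaErr K₀ δ m
    set bb := betaErr δ m w
    set g := gammaErr m w
    set a' := (1 + K₀ * s) ^ m - 1
    set b' := betaBar m s
    set g' := gammaErr m w₀
    have ha'0 : 0 ≤ a' := hα0.trans hα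
    have hb'0 : 0 ≤ b' := betaBar_nonneg m hs0
    have h1' : 0 ≤ (1 + a') * (1 + 2 * b') := by positivity
    have : (1 + a) * (1 + 2 * bb) * (1 + g) ≤ (1 + a') * (1 + 2 * b') * (1 + g') := by
      gcongr
    have e : (1 + a') * (1 + 2 * b') * (1 + g') - 1 = ((1 + a') * (1 + 2 * b') - 1) * (1 + g') + g' := by ring
    linarith
  -- tail coefficient
  have htail : ((K + CB) ^ (3 * m) * Real.exp (2 * 4 ^ m) * K ^ m + 1) * ((Real.sqrt K) ^ (8 * m + 2))⁻¹ ≤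
      ((1 + CB) ^ (3 * m) * Real.exp (2 * 4 ^ m) + 1) * K⁻¹ := by
    set cc := Real.exp (2 * 4 ^ m) with hcc
    have hT : Real.sqrt K ^ (8 * m + 2) = K ^ (4 * m + 1) := by
      rw [show 8 * m + 2 = 2 * (4 * m + 1) by ring, pow_mul, Real.sq_sqrt hK0.le]
    rw [hT]
    have h1 : (K + CB) ^ (3 * m) ≤ ((1 + CB) * K) ^ (3 * m) :=
      pow_le_pow_left₀ (by positivity) (by nlinarith) _
    have h2 : (K + CB) ^ (3 * m) * cc * K ^ m + 1 ≤ ((1 + CB) ^ (3 * m) * cc + 1) * K ^ (4 * m) := by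
      have h3 : (1 : ℝ) ≤ K ^ (4 * m) := one_le_pow₀ hK
      calc (K + CB) ^ (3 * m) * cc * K ^ m + 1 ≤ ((1 + CB) * K) ^ (3 * m) * cc * K ^ m + K ^ (4 * m) := by gcongr
        _ = ((1 + CB) ^ (3 * m) * cc + 1) * K ^ (4 * m) := by rw [mul_pow]; ring
    calc ((K + CB) ^ (3 * m) * cc * K ^ m + 1) * (K ^ (4 * m + 1))⁻¹
        ≤ (((1 + CB) ^ (3 * m) * cc + 1) * K ^ (4 * m)) * (K ^ (4 * m + 1))⁻¹ := by gcongr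
      _ = ((1 + CB) ^ (3 * m) * cc + 1) * K⁻¹ := by rw [pow_succ]; field_simp
  -- the box error
  have herr3 : K ^ m * (R ^ (2 * m) * ((n + 1 : ℕ) * (R ^ (2 * m) / R ^ (10 * m)))) ≤ ((n + 1 : ℕ) : ℝ) * K⁻¹ := by
    have hKR : K ≤ R := (Real.log_le_sub_one_of_pos hR).trans (by linarith)
    have hR1 : 1 ≤ R := hK.trans hKR
    have heq : K ^ m * (R ^ (2 * m) * ((n + 1 : ℕ) * (R ^ (2 * m) / R ^ (10 * m)))) =
        (n + 1 : ℕ) * (K ^ m * R ^ (4 * m)) / R ^ (10 * m) := by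
      rw [show (4 : ℕ) * m = 2 * m + 2 * m by ring, pow_add]; ring
    rw [heq, div_le_iff₀ (by positivity)]
    have hkey : K ^ m * R ^ (4 * m) * K ≤ R ^ (10 * m) := by
      calc K ^ m * R ^ (4 * m) * K = K ^ (m + 1) * R ^ (4 * m) := by ring
        _ ≤ R ^ (m + 1) * R ^ (4 * m) := by gcongr
        _ = R ^ (5 * m + 1) := by rw [← pow_add]; ring_nf
        _ ≤ R ^ (10 * m) := pow_le_pow_right₀ hR1 (by omega)
    calc ((n + 1 : ℕ) : ℝ) * (K ^ m * R ^ (4 * m)) = ((n + 1 : ℕ) : ℝ) * K⁻¹ * (K ^ m * R ^ (4 * m) * K) := by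
          field_simp
      _ ≤ ((n + 1 : ℕ) : ℝ) * K⁻¹ * R ^ (10 * m) := by gcongr
  -- assemble
  have hM₂ : 0 ≤ ∫ x, phiWeight χ x := integral_nonneg (phiWeight_nonneg χ)
  have hMA : 0 ≤ weightMoment χ (8 * m + 2) := weightMoment_nonneg χ _
  have htot0 : 0 ≤ totErr K₀ δ m w := totErr_nonneg hK₀ hδ m w
  unfold fixedErr
  refine div_le_div_of_nonneg_right ?_ (by positivity)
  have e1 : ((K + CB) ^ (3 * m) * Real.exp (2 * 4 ^ m) * K ^ m + 1) *
      ((2 * m : ℕ) * (((Real.sqrt K) ^ (8 * m + 2))⁻¹ * weightMoment χ (8 * m + 2)) * (∫ x, phiWeight χ x) ^ (2 * m - 1)) =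
      (((K + CB) ^ (3 * m) * Real.exp (2 * 4 ^ m) * K ^ m + 1) * ((Real.sqrt K) ^ (8 * m + 2))⁻¹) *
        ((2 * m : ℕ) * weightMoment χ (8 * m + 2) * (∫ x, phiWeight χ x) ^ (2 * m - 1)) := by ring
  rw [e1]
  gcongr

/-- **The smooth Goldston–Yıldırım box estimate with range-uniform cutoff.** For a smooth `χ`
supported in `[-1,1]` with `|χ| ≤ 1` and `c_χ > 0`, `m ≥ 1` forms in `n + 1` variables with
coefficients bounded by `C₀`, and `ε > 0`: there are `K₁` and `w₀` such that for every `R > 0` with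
`log R ≥ K₁`, every cutoff `w₀ ≤ w ≤ (log R)^{1/8}`, every integer system with `|L_{ij}| ≤ C₀`,
nonzero pairwise non-proportional rows, all shifts `b`, and all boxes of sides `≥ R^{10m}`,
`|E_{x∈B} ∏_i Λ_{χ,R}(W(∑_j L_{ij} x_j + b_i) + 1)² / (c_χ W log R/φ(W))^m - 1| ≤ ε`.
This is the tree's `CFZ.smoothLinearFormsEstimate_holds` with the level `R` free (rather than
`R = N^{k⁻¹2^{-k-4}}` along the primes `N`) and the cutoff range-uniform (rather than functional).
[cite: ConlonFoxZhao2014, Proposition 8.3 and Section 9] [cite: GreenTao2010, App. D, Thm. D.3] -/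
theorem box_estimate {χ : ℝ → ℝ} (hs : ContDiff ℝ (⊤ : ℕ∞) χ) (hsupp : ∀ x, 1 ≤ |x| → χ x = 0)
    (hχ1 : ∀ x, |χ x| ≤ 1) (hcχ : 0 < cChi χ) (m n C₀ : ℕ) (hm : 1 ≤ m) {ε : ℝ} (hε : 0 < ε) :
    ∃ K₁ : ℝ, 1 ≤ K₁ ∧ ∃ w₀ : ℕ, ∀ R : ℝ, 0 < R → K₁ ≤ Real.log R →
      ∀ w : ℕ, w₀ ≤ w → (w : ℝ) ≤ Real.log R ^ (1 / 8 : ℝ) →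
      ∀ L : Fin m → Fin (n + 1) → ℤ, (∀ i j, |L i j| ≤ C₀) → (∀ i, L i ≠ 0) →
        (∀ i i', i ≠ i' → ∀ c : ℚ, (fun j => (L i j : ℚ)) ≠ c • fun j => (L i' j : ℚ)) →
      ∀ (b : Fin m → ℤ) (a : Fin (n + 1) → ℤ) (ℓ : Fin (n + 1) → ℕ), (∀ j, R ^ (10 * m) ≤ ℓ j) →
        |(𝔼 x ∈ Fintype.piFinset (fun j => Ico (a j) (a j + ℓ j)),
            ∏ i, smoothDivisorSum χ R (primorial w * (∑ j, L i j * x j + b i) + 1) ^ 2) /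
            (cChi χ * (primorial w : ℝ) * Real.log R / Nat.totient (primorial w)) ^ m - 1| ≤ ε := by
  obtain ⟨δ₀, K₀, hδ₀pos, hK₀, hζ⟩ := norm_zetaRatio_sub_le
  obtain ⟨CB, hCB0, hCB⟩ := exists_norm_prod_eulerFactor_le
  set M₂ := ∫ x, phiWeight χ x with hM₂_def
  set MA := weightMoment χ (8 * m + 2) with hMA_def
  set ct := ((1 + CB) ^ (3 * m) * Real.exp (2 * 4 ^ m) + 1) * ((2 * m : ℕ) * MA * M₂ ^ (2 * m - 1)) with hct_def
  have hM₂ : 0 ≤ M₂ := integral_nonneg (phiWeight_nonneg χ)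
  have hMA : 0 ≤ MA := weightMoment_nonneg χ _
  have hct : 0 ≤ ct := by positivity
  -- the auxiliary smallness `ε₁`
  set ε₁ : ℝ := min 1 (ε * cChi χ ^ m / (3 * M₂ ^ (2 * m) + ct + (n + 1 : ℕ) + 1)) with hε₁_def
  have hden : 0 < 3 * M₂ ^ (2 * m) + ct + (n + 1 : ℕ) + 1 := by positivity
  have hε₁ : 0 < ε₁ := lt_min one_pos (div_pos (mul_pos hε (pow_pos hcχ m)) hden)
  have hε₁1 : ε₁ ≤ 1 := min_le_left _ _
  have hε₁b : ε₁ * (3 * M₂ ^ (2 * m) + ct + (n + 1 : ℕ) + 1) ≤ ε * cChi χ ^ m := by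
    have := min_le_right 1 (ε * cChi χ ^ m / (3 * M₂ ^ (2 * m) + ct + (n + 1 : ℕ) + 1))
    rw [← hε₁_def] at this
    rwa [le_div_iff₀ hden] at this
  -- thresholds in `K`
  have hPev : ∀ᶠ K in atTop, pBar K₀ m (sOf K) ≤ ε₁ := ((tendsto_pBar K₀ m).comp tendsto_sOf).eventually_le_const hε₁
  have hYev : ∀ᶠ K in atTop, betaBar m (sOf K) ≤ 1 / 2 :=
    ((tendsto_betaBar m).comp tendsto_sOf).eventually_le_const (by norm_num)
  have hsev : ∀ᶠ K in atTop, sOf K ≤ min δ₀ (1 / 16) := tendsto_sOf.eventually_le_const (lt_min hδ₀pos (by norm_num))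
  have hinv : ∀ᶠ K : ℝ in atTop, K⁻¹ ≤ ε₁ := tendsto_inv_atTop_zero.eventually_le_const hε₁
  obtain ⟨K₁', hK₁'⟩ := Filter.eventually_atTop.1 (((hPev.and hYev).and hsev).and hinv)
  -- threshold in `w`
  have hγev : ∀ᶠ w₀ : ℕ in atTop, gammaErr m w₀ ≤ ε₁ := (tendsto_gamma m tendsto_id).eventually_le_const hε₁
  obtain ⟨w₁, hw₁⟩ := Filter.eventually_atTop.1 hγev
  set w₀ := max (max (21 * m + 2) (2 * C₀ ^ 2)) (max 1 w₁) with hw₀_def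
  refine ⟨max K₁' 1, le_max_right _ _, w₀, fun R hR0 hKR w hw hwK L hLC hL0 hLp b a ℓ hℓ => ?_⟩
  obtain ⟨⟨⟨hP, hY⟩, hsm⟩, hinvK⟩ := hK₁' (Real.log R) ((le_max_left _ _).trans hKR)
  have hK1 : 1 ≤ Real.log R := (le_max_right _ _).trans hKR
  set K := Real.log R with hK_def
  have hexp : Real.exp 1 ≤ R := (Real.le_log_iff_exp_le hR0).1 hK1
  have hw21 : 21 * m + 2 ≤ w := le_trans ((le_max_left _ _).trans (le_max_left _ _)) hw
  have hwC : 2 * C₀ ^ 2 ≤ w := le_trans ((le_max_right _ _).trans (le_max_left _ _)) hw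
  have hw₀1 : 1 ≤ w₀ := (le_max_left _ _).trans (le_max_right _ _)
  have hw₁' : w₁ ≤ w₀ := (le_max_right _ _).trans (le_max_right _ _)
  have S : Setup m n R w C₀ L := ⟨hexp, hw21, hwC, hLC, hL0, hLp⟩
  have hT : 1 ≤ Real.sqrt K := by
    rw [show (1 : ℝ) = Real.sqrt 1 by simp]
    exact Real.sqrt_le_sqrt hK1
  obtain ⟨hδs, hδlog, hβY, hfix⟩ := fixedErr_le_uniform χ hm hK₀ hCB0 hR0 hK1 hw₀1 hw hwK hcχ
  have hδ₀' : deltaOf R (Real.sqrt K) ≤ δ₀ := hδs.trans (hsm.trans (min_le_left _ _))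
  have hδw : 2 * deltaOf R (Real.sqrt K) * Real.log w ≤ 1 / 8 := by
    have := hsm.trans (min_le_right _ _)
    linarith
  have hβ : betaErr (deltaOf R (Real.sqrt K)) m w ≤ 1 / 2 := hβY.trans hY
  have hB : ∀ (b : Fin m → ℤ) (Q : ℕ) (η : Fin m ⊕ Fin m → ℝ),
      ‖∏ p ∈ Q.primesBelow, eulerFactor p (primorial w) L b (zL R η) (zR R η)‖ ≤
        (Real.log R + CB) ^ (3 * m) * Real.exp (2 * 4 ^ m) :=
    fun b Q η => hCB m n _ S.one_le_log w C₀ hwC L hLC hL0 hLp b Q η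
  refine (abs_expect_div_sub_one_le_signed S hs hsupp hχ1 hcχ hT hK₀ hζ hδ₀' hδw hβ hCB0 hB (8 * m + 2) b a ℓ hℓ).trans
    (hfix.trans ?_)
  -- the final numerics
  have hγ₁ : gammaErr m w₀ ≤ ε₁ := hw₁ w₀ hw₁'
  have hγ0 : 0 ≤ gammaErr m w₀ := gammaErr_nonneg m w₀
  have hs0 : 0 ≤ sOf K := (deltaOf_nonneg (Real.sqrt_nonneg _) (by linarith : 0 < K)).trans hδs
  have hP0 : 0 ≤ pBar K₀ m (sOf K) := by
    unfold pBar
    have h1 : 1 ≤ (1 + K₀ * sOf K) ^ m := one_le_pow₀ (le_add_of_nonneg_right (mul_nonneg hK₀ hs0))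
    have h2 : 0 ≤ betaBar m (sOf K) := betaBar_nonneg m hs0
    have h3 : (1 : ℝ) * 1 ≤ (1 + ((1 + K₀ * sOf K) ^ m - 1)) * (1 + 2 * betaBar m (sOf K)) :=
      mul_le_mul (by linarith) (by linarith) zero_le_one (by linarith)
    linarith
  have hnum1 : pBar K₀ m (sOf K) * (1 + gammaErr m w₀) + gammaErr m w₀ ≤ 3 * ε₁ := by
    have h1 : pBar K₀ m (sOf K) * (1 + gammaErr m w₀) ≤ ε₁ * 2 :=
      mul_le_mul hP (by linarith) (by positivity) hε₁.le
    linarith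
  rw [div_le_iff₀ (pow_pos hcχ m)]
  calc (pBar K₀ m (sOf K) * (1 + gammaErr m w₀) + gammaErr m w₀) * M₂ ^ (2 * m) +
        ((1 + CB) ^ (3 * m) * Real.exp (2 * 4 ^ m) + 1) * K⁻¹ * ((2 * m : ℕ) * MA * M₂ ^ (2 * m - 1)) +
        ((n + 1 : ℕ) : ℝ) * K⁻¹
      ≤ 3 * ε₁ * M₂ ^ (2 * m) + ct * ε₁ + ((n + 1 : ℕ) : ℝ) * ε₁ := by
        have : ((1 + CB) ^ (3 * m) * Real.exp (2 * 4 ^ m) + 1) * K⁻¹ * ((2 * m : ℕ) * MA * M₂ ^ (2 * m - 1)) =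
            ct * K⁻¹ := by rw [hct_def]; ring
        rw [this]
        gcongr
    _ = ε₁ * (3 * M₂ ^ (2 * m) + ct + (n + 1 : ℕ)) := by ring
    _ ≤ ε₁ * (3 * M₂ ^ (2 * m) + ct + (n + 1 : ℕ) + 1) := mul_le_mul_of_nonneg_left (by linarith) hε₁.le
    _ ≤ ε * cChi χ ^ m := hε₁b

end Engine


/-! ### Cells: cutting `K ∩ ℤ^d` into cubes of side `ρ` -/

section Cells

variable {n : ℕ}

/-- The index `m = ⌊x/ρ⌋` of the cube of side `ρ` containing the lattice point `x`. [folklore] -/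
def cellIdx (ρ : ℕ) (x : Fin (n + 1) → ℤ) : Fin (n + 1) → ℤ := fun e => x e / ρ

/-- The lattice points of the cube `mρ + [0, ρ)^d`. [folklore] -/
def cellPts (ρ : ℕ) (m : Fin (n + 1) → ℤ) : Finset (Fin (n + 1) → ℤ) :=
  Fintype.piFinset fun e => Ico (m e * ρ) (m e * ρ + ρ)

/-- `x ∈ mρ + [0,ρ)^d` iff `⌊x/ρ⌋ = m`. [folklore] -/
theorem mem_cellPts_iff {ρ : ℕ} (hρ : 1 ≤ ρ) {m x : Fin (n + 1) → ℤ} : x ∈ cellPts ρ m ↔ cellIdx ρ x = m := by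
  have hρ' : (0 : ℤ) < ρ := by exact_mod_cast hρ
  simp only [cellPts, Fintype.mem_piFinset, mem_Ico, cellIdx, funext_iff]
  refine forall_congr' fun e => ?_
  constructor
  · rintro ⟨h1, h2⟩
    refine le_antisymm ?_ ((Int.le_ediv_iff_mul_le hρ').2 h1)
    exact Int.lt_add_one_iff.1 ((Int.ediv_lt_iff_lt_mul hρ').2 (by linarith))
  · intro h
    constructor
    · exact (Int.le_ediv_iff_mul_le hρ').1 h.ge
    · have := (Int.ediv_lt_iff_lt_mul hρ').1 (Int.lt_add_one_iff.2 h.le)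
      linarith

/-- `#(mρ + [0,ρ)^d ∩ ℤ^d) = ρ^d`. [folklore] -/
theorem card_cellPts (ρ : ℕ) (m : Fin (n + 1) → ℤ) : #(cellPts ρ m) = ρ ^ (n + 1) := by
  unfold cellPts
  rw [Fintype.card_piFinset]
  simp only [Int.card_Ico, add_sub_cancel_left, Int.toNat_natCast, prod_const, card_univ, Fintype.card_fin]

/-- The lattice points of a cell lie in the closed cube `cellBox ρ 0 m`. [folklore] -/
theorem realPoint_mem_cellBox {ρ : ℕ} {m x : Fin (n + 1) → ℤ} (hx : x ∈ cellPts ρ m) :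
    realPoint x ∈ cellBox ρ 0 m := by
  simp only [cellPts, Fintype.mem_piFinset, mem_Ico] at hx
  constructor
  · intro e
    have := (hx e).1
    simp only [realPoint, Int.cast_mul, Int.cast_natCast, CharP.cast_eq_zero, sub_zero]
    exact_mod_cast this
  · intro e
    have := (hx e).2
    simp only [realPoint, Int.cast_add, Int.cast_mul, Int.cast_natCast, Int.cast_one, CharP.cast_eq_zero, add_zero]
    have h' : x e ≤ (m e + 1) * ρ := by linarith
    exact_mod_cast h'

/-- The cell index of a point of `[-N,N]^d` lies in `[-(N/ρ + 2), N/ρ + 2]^d`. [folklore] -/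
theorem cellIdx_mem_latticeBox {ρ N : ℕ} (hρ : 1 ≤ ρ) {x : Fin (n + 1) → ℤ} (hx : x ∈ latticeBox (n + 1) N) :
    cellIdx ρ x ∈ latticeBox (n + 1) (N / ρ + 2) := by
  have hρ' : (0 : ℤ) < ρ := by exact_mod_cast hρ
  simp only [latticeBox, Fintype.mem_piFinset, mem_Icc] at hx ⊢
  intro e
  obtain ⟨h1, h2⟩ := hx e
  constructor
  · -- `-(N/ρ) - 1 ≤ (-N)/ρ ≤ x/ρ`
    have h3 : (-(N : ℤ)) / ρ ≤ x e / ρ := Int.ediv_le_ediv hρ' h1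
    have h4 : -((N : ℤ) / ρ) - 1 ≤ (-(N : ℤ)) / ρ := by
      rw [Int.le_ediv_iff_mul_le hρ']
      have := Int.lt_ediv_add_one_mul_self (N : ℤ) hρ'
      nlinarith
    push_cast
    unfold cellIdx
    linarith
  · have h3 : x e / ρ ≤ (N : ℤ) / ρ := Int.ediv_le_ediv hρ' h2
    push_cast
    unfold cellIdx
    linarith

open Classical in
/-- The cells of a good index are full: if `cellBox ρ 0 m ⊆ K ⊆ [-N,N]^d` then the points of
`K ∩ ℤ^d` with index `m` are exactly the `ρ^d` lattice points of the cell. [folklore] -/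
theorem filter_cellIdx_eq_cellPts {ρ N : ℕ} (hρ : 1 ≤ ρ) {K : Set (Fin (n + 1) → ℝ)} (hKN : K ⊆ realBox (n + 1) N)
    {m : Fin (n + 1) → ℤ} (hm : cellBox ρ 0 m ⊆ K) :
    ((latticeBox (n + 1) N).filter fun x => realPoint x ∈ K).filter (fun x => cellIdx ρ x = m) = cellPts ρ m := by
  ext x
  simp only [mem_filter]
  constructor
  · rintro ⟨-, h⟩
    exact (mem_cellPts_iff hρ).2 h
  · intro hx
    have hK : realPoint x ∈ K := hm (realPoint_mem_cellBox hx)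
    refine ⟨⟨?_, hK⟩, (mem_cellPts_iff hρ).1 hx⟩
    have hB := hKN hK
    simp only [latticeBox, Fintype.mem_piFinset, mem_Icc]
    intro e
    have h1 := hB.1 e
    have h2 := hB.2 e
    simp only [realPoint] at h1 h2
    exact ⟨by exact_mod_cast h1, by exact_mod_cast h2⟩

open Classical in
/-- The points of `K ∩ ℤ^d` with index `m` lie in the cell `m`. [folklore] -/
theorem filter_cellIdx_subset {ρ N : ℕ} (hρ : 1 ≤ ρ) (K : Set (Fin (n + 1) → ℝ)) (m : Fin (n + 1) → ℤ) :
    ((latticeBox (n + 1) N).filter fun x => realPoint x ∈ K).filter (fun x => cellIdx ρ x = m) ⊆ cellPts ρ m :=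
  fun _ hx => (mem_cellPts_iff hρ).2 (mem_filter.1 hx).2

open Classical in
/-- A cell whose box misses `K` carries no point of `K ∩ ℤ^d`. [folklore] -/
theorem filter_cellIdx_eq_empty {ρ N : ℕ} (hρ : 1 ≤ ρ) {K : Set (Fin (n + 1) → ℝ)} {m : Fin (n + 1) → ℤ}
    (hm : ¬ (cellBox ρ 0 m ∩ K).Nonempty) :
    ((latticeBox (n + 1) N).filter fun x => realPoint x ∈ K).filter (fun x => cellIdx ρ x = m) = ∅ := by
  rw [Finset.eq_empty_iff_forall_notMem]
  intro x hx
  simp only [mem_filter] at hx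
  exact hm ⟨realPoint x, realPoint_mem_cellBox ((mem_cellPts_iff hρ).2 hx.2), hx.1.2⟩

open Classical in
/-- The good cells: closed cube inside `K`. [folklore] -/
def goodCells (ρ N : ℕ) (K : Set (Fin (n + 1) → ℝ)) : Finset (Fin (n + 1) → ℤ) :=
  (latticeBox (n + 1) (N / ρ + 2)).filter fun m => cellBox ρ 0 m ⊆ K

open Classical in
/-- The boundary cells: closed cube meeting `K` but not inside it. [folklore] -/
def badCells (ρ N : ℕ) (K : Set (Fin (n + 1) → ℝ)) : Finset (Fin (n + 1) → ℤ) :=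
  (latticeBox (n + 1) (N / ρ + 2)).filter fun m => (cellBox ρ 0 m ∩ K).Nonempty ∧ ¬ cellBox ρ 0 m ⊆ K

/-- **The number of boundary cells** (the tree's `card_boundaryCells_le` with `q = 0`).
[cite: GreenTao2010, App. A (Lemma A.1, Cor. A.2)] -/
theorem card_badCells_le {ρ N : ℕ} (hρ : 1 ≤ ρ) {K : Set (Fin (n + 1) → ℝ)} (hK : Convex ℝ K)
    (hKN : K ⊆ realBox (n + 1) N) :
    (#(badCells ρ N K) : ℝ) ≤ 6 * (n + 1) * (2 * ((N / ρ + 2 : ℕ) : ℝ) + 6) ^ n :=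
  card_boundaryCells_le hρ (q := 0) (by omega) hK hKN _ (Finset.Subset.refl _)

open Classical in
/-- **The cell sandwich.** For `F ≥ 0` on `ℤ^d`, `K ⊆ [-N,N]^d` and a mesh `ρ ≥ 1`, with `G` the good
and `B` the boundary cells:
`∑_{m ∈ G} ∑_{cell m} F ≤ ∑_{K ∩ ℤ^d} F ≤ ∑_{m ∈ G} ∑_{cell m} F + ∑_{m ∈ B} ∑_{cell m} F`, and
`#G ρ^d ≤ #(K ∩ ℤ^d) ≤ (#G + #B) ρ^d`. [folklore] -/
theorem cell_sandwich {ρ N : ℕ} (hρ : 1 ≤ ρ) {K : Set (Fin (n + 1) → ℝ)} (hKN : K ⊆ realBox (n + 1) N)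
    (F : (Fin (n + 1) → ℤ) → ℝ) (hF : ∀ x, 0 ≤ F x) :
    (∑ m ∈ goodCells ρ N K, ∑ x ∈ cellPts ρ m, F x ≤ ∑ x ∈ (latticeBox (n + 1) N).filter (fun x => realPoint x ∈ K), F x) ∧
    (∑ x ∈ (latticeBox (n + 1) N).filter (fun x => realPoint x ∈ K), F x ≤
      ∑ m ∈ goodCells ρ N K, ∑ x ∈ cellPts ρ m, F x + ∑ m ∈ badCells ρ N K, ∑ x ∈ cellPts ρ m, F x) ∧
    ((#(goodCells ρ N K) : ℝ) * (ρ : ℝ) ^ (n + 1) ≤ #((latticeBox (n + 1) N).filter (fun x => realPoint x ∈ K))) ∧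
    ((#((latticeBox (n + 1) N).filter (fun x => realPoint x ∈ K)) : ℝ) ≤
      (#(goodCells ρ N K) + #(badCells ρ N K)) * (ρ : ℝ) ^ (n + 1)) := by
  set A := (latticeBox (n + 1) N).filter fun x => realPoint x ∈ K with hA_def
  set Ms := latticeBox (n + 1) (N / ρ + 2) with hMs_def
  have hG_def : goodCells ρ N K = Ms.filter fun m => cellBox ρ 0 m ⊆ K := rfl
  have hB_def : badCells ρ N K = Ms.filter fun m => (cellBox ρ 0 m ∩ K).Nonempty ∧ ¬ cellBox ρ 0 m ⊆ K := rfl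
  set G := goodCells ρ N K
  set B := badCells ρ N K
  have hmaps : ∀ x ∈ A, cellIdx ρ x ∈ Ms := fun x hx => cellIdx_mem_latticeBox hρ (mem_filter.1 hx).1
  -- fibrewise decomposition of the sum and of the count
  have hsum : ∑ x ∈ A, F x = ∑ m ∈ Ms, ∑ x ∈ A.filter (fun x => cellIdx ρ x = m), F x :=
    (Finset.sum_fiberwise_of_maps_to hmaps F).symm
  have hcard : (#A : ℝ) = ∑ m ∈ Ms, (#(A.filter fun x => cellIdx ρ x = m) : ℝ) := by
    have h := (Finset.sum_fiberwise_of_maps_to hmaps (fun _ => (1 : ℝ))).symm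
    simpa using h
  -- the three kinds of cells
  have hfib_good : ∀ m ∈ G, A.filter (fun x => cellIdx ρ x = m) = cellPts ρ m := fun m hm => by
    rw [hG_def] at hm
    exact filter_cellIdx_eq_cellPts hρ hKN (mem_filter.1 hm).2
  have hfib_sub : ∀ m, A.filter (fun x => cellIdx ρ x = m) ⊆ cellPts ρ m := fun m => filter_cellIdx_subset hρ K m
  have hfib_le : ∀ m, ∑ x ∈ A.filter (fun x => cellIdx ρ x = m), F x ≤ ∑ x ∈ cellPts ρ m, F x := fun m =>
    Finset.sum_le_sum_of_subset_of_nonneg (hfib_sub m) fun x _ _ => hF x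
  have hfib_zero : ∀ m ∈ Ms, m ∉ G → m ∉ B → A.filter (fun x => cellIdx ρ x = m) = ∅ := by
    intro m hm hG hB
    have hG' : ¬ cellBox ρ 0 m ⊆ K := fun h => hG (by rw [hG_def]; exact mem_filter.2 ⟨hm, h⟩)
    have hB' : ¬ (cellBox ρ 0 m ∩ K).Nonempty := fun h => hB (by rw [hB_def]; exact mem_filter.2 ⟨hm, h, hG'⟩)
    exact filter_cellIdx_eq_empty hρ hB'
  have hGB : Disjoint G B := by
    rw [hG_def, hB_def, Finset.disjoint_filter]
    intro m _ h1 h2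
    exact h2.2 h1
  have hGBsub : G ∪ B ⊆ Ms := by
    rw [hG_def, hB_def]
    exact union_subset (filter_subset _ _) (filter_subset _ _)
  -- splitting sums over `Ms` into `G`, `B` and the rest
  have hsplit : ∀ f : (Fin (n + 1) → ℤ) → ℝ, (∀ m ∈ Ms, m ∉ G → m ∉ B → f m = 0) →
      ∑ m ∈ Ms, f m = ∑ m ∈ G, f m + ∑ m ∈ B, f m := by
    intro f hf
    rw [← Finset.sum_union hGB, ← Finset.sum_subset hGBsub]
    intro m hm hmn
    rw [mem_union, not_or] at hmn
    exact hf m hm hmn.1 hmn.2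
  refine ⟨?_, ?_, ?_, ?_⟩
  · rw [hsum, hsplit _ (fun m hm hG hB => by rw [hfib_zero m hm hG hB, sum_empty])]
    have h1 : ∑ m ∈ G, ∑ x ∈ cellPts ρ m, F x = ∑ m ∈ G, ∑ x ∈ A.filter (fun x => cellIdx ρ x = m), F x :=
      sum_congr rfl fun m hm => by rw [hfib_good m hm]
    rw [h1]
    exact le_add_of_nonneg_right (sum_nonneg fun m _ => sum_nonneg fun x _ => hF x)
  · rw [hsum, hsplit _ (fun m hm hG hB => by rw [hfib_zero m hm hG hB, sum_empty])]
    exact add_le_add (le_of_eq (sum_congr rfl fun m hm => by rw [hfib_good m hm])) (sum_le_sum fun m _ => hfib_le m)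
  · rw [hcard, hsplit _ (fun m hm hG hB => by rw [hfib_zero m hm hG hB]; simp)]
    have h1 : ∑ m ∈ G, (#(A.filter fun x => cellIdx ρ x = m) : ℝ) = #G * (ρ : ℝ) ^ (n + 1) := by
      rw [sum_congr rfl fun m hm => by rw [hfib_good m hm, card_cellPts], sum_const, nsmul_eq_mul]
      push_cast; ring
    rw [h1]
    exact le_add_of_nonneg_right (sum_nonneg fun m _ => Nat.cast_nonneg _)
  · rw [hcard, hsplit _ (fun m hm hG hB => by rw [hfib_zero m hm hG hB]; simp)]
    have hle : ∀ m, (#(A.filter fun x => cellIdx ρ x = m) : ℝ) ≤ (ρ : ℝ) ^ (n + 1) := fun m => by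
      have := card_le_card (hfib_sub m)
      rw [card_cellPts] at this
      exact_mod_cast this
    calc ∑ m ∈ G, (#(A.filter fun x => cellIdx ρ x = m) : ℝ) + ∑ m ∈ B, (#(A.filter fun x => cellIdx ρ x = m) : ℝ)
        ≤ ∑ _m ∈ G, (ρ : ℝ) ^ (n + 1) + ∑ _m ∈ B, (ρ : ℝ) ^ (n + 1) :=
          add_le_add (sum_le_sum fun m _ => hle m) (sum_le_sum fun m _ => hle m)
      _ = (#G + #B) * (ρ : ℝ) ^ (n + 1) := by rw [sum_const, sum_const, nsmul_eq_mul, nsmul_eq_mul]; ring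

/-- **From the sandwich to the count**, pure arithmetic: if `(1-e) c Gμ ≤ S ≤ (1+e) c (G+B)μ`,
`Gμ ≤ Cnt ≤ (G+B)μ` and `|Cnt - V| ≤ E` (all quantities `≥ 0`, `e ≤ 1`) then
`|S - cV| ≤ e c V + 2 c (E + Bμ)`. [folklore] -/
theorem abs_sub_le_of_sandwich {S G B Cnt V E μ c e : ℝ} (hc : 0 ≤ c) (he0 : 0 ≤ e) (he1 : e ≤ 1)
    (hμ : 0 ≤ μ) (hB : 0 ≤ B)
    (hS1 : (1 - e) * c * (G * μ) ≤ S) (hS2 : S ≤ (1 + e) * c * ((G + B) * μ))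
    (hC1 : G * μ ≤ Cnt) (hC2 : Cnt ≤ (G + B) * μ) (hCV : |Cnt - V| ≤ E) :
    |S - c * V| ≤ e * c * V + 2 * c * (E + B * μ) := by
  have hE0 : 0 ≤ E := (abs_nonneg _).trans hCV
  obtain ⟨hCV1, hCV2⟩ := abs_le.1 hCV
  rw [abs_le]
  constructor
  · -- lower bound: `S ≥ (1-e) c (V - E - Bμ)`
    have h1 : V - E - B * μ ≤ G * μ := by nlinarith
    have h2 : (1 - e) * c * (V - E - B * μ) ≤ (1 - e) * c * (G * μ) :=
      mul_le_mul_of_nonneg_left h1 (mul_nonneg (by linarith) hc)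
    have h3 : 0 ≤ c * (E + B * μ) := by positivity
    have h4 : 0 ≤ e * (c * (E + B * μ)) := by positivity
    nlinarith
  · have h1 : (G + B) * μ ≤ V + E + B * μ := by nlinarith
    have h2 : (1 + e) * c * ((G + B) * μ) ≤ (1 + e) * c * (V + E + B * μ) :=
      mul_le_mul_of_nonneg_left h1 (by positivity)
    have h3 : 0 ≤ c * (E + B * μ) := by positivity
    nlinarith

end Cells


/-! ### Thresholds and elementary bounds for the assembly -/

section Prelim

open Literature.NumberTheory.Sieve.GreenTao2008

/-- `½ log log N ≤ (γ log N)^{1/8}` for `N ≥ N₁(γ)` (`log u = o(u^{1/8})`). [folklore] -/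
theorem exists_loglog_le {γ : ℝ} (hγ : 0 < γ) :
    ∃ N₁ : ℕ, ∀ N : ℕ, N₁ ≤ N → Real.log (Real.log N) / 2 ≤ (γ * Real.log N) ^ (1 / 8 : ℝ) := by
  have ho := (isLittleO_log_rpow_atTop (by norm_num : (0 : ℝ) < 1 / 8)).bound (Real.rpow_pos_of_pos hγ (1 / 8))
  obtain ⟨x₀, hx₀⟩ := Filter.eventually_atTop.1 ho
  refine ⟨⌈Real.exp (max x₀ 0)⌉₊, fun N hN => ?_⟩
  have hN0 : (0 : ℝ) < N := by
    have : (0 : ℝ) < ⌈Real.exp (max x₀ 0)⌉₊ := by exact_mod_cast Nat.ceil_pos.2 (Real.exp_pos _)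
    exact this.trans_le (by exact_mod_cast hN)
  have hlogN : max x₀ 0 ≤ Real.log N := by
    rw [Real.le_log_iff_exp_le hN0]
    exact (Nat.le_ceil _).trans (by exact_mod_cast hN)
  have hlog0 : 0 ≤ Real.log N := (le_max_right _ _).trans hlogN
  by_cases hll : Real.log (Real.log N) ≤ 0
  · exact (by linarith : Real.log (Real.log N) / 2 ≤ 0).trans (Real.rpow_nonneg (by positivity) _)
  · push Not at hll
    have h := hx₀ (Real.log N) ((le_max_left _ _).trans hlogN)
    rw [Real.norm_eq_abs, Real.norm_eq_abs, abs_of_pos hll, abs_of_nonneg (Real.rpow_nonneg hlog0 _)] at h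
    rw [Real.mul_rpow hγ.le hlog0]
    linarith

/-- `γ log N ≥ K₁` for `N ≥ ⌈exp(K₁/γ)⌉`. [folklore] -/
theorem le_mul_log_of_le {γ K₁ : ℝ} (hγ : 0 < γ) {N : ℕ} (hN : ⌈Real.exp (K₁ / γ)⌉₊ ≤ N) : K₁ ≤ γ * Real.log N := by
  have hN0 : (0 : ℝ) < N := by
    have : (0 : ℝ) < ⌈Real.exp (K₁ / γ)⌉₊ := by exact_mod_cast Nat.ceil_pos.2 (Real.exp_pos _)
    exact this.trans_le (by exact_mod_cast hN)
  have : K₁ / γ ≤ Real.log N := by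
    rw [Real.le_log_iff_exp_le hN0]
    exact (Nat.le_ceil _).trans (by exact_mod_cast hN)
  rwa [div_le_iff₀ hγ, mul_comm] at this

/-- `vol(K) ≤ (2N)^d` for `K ⊆ [-N,N]^d`. [folklore] -/
theorem volume_toReal_le_of_subset_realBox {d : ℕ} {N : ℕ} {K : Set (Fin d → ℝ)} (hKN : K ⊆ realBox d N) :
    (volume K).toReal ≤ (2 * N : ℝ) ^ d := by
  have hB : (volume (realBox d (N : ℝ))).toReal = (2 * N : ℝ) ^ d := by
    unfold realBox
    rw [Real.volume_Icc_pi_toReal (fun _ => by simp)]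
    simp only [sub_neg_eq_add, prod_const, card_univ, Fintype.card_fin]
    ring
  rw [← hB]
  refine ENNReal.toReal_mono ?_ (measure_mono hKN)
  unfold realBox
  exact measure_Icc_lt_top.ne

/-- The coefficients of a system of size `‖Ψ‖_N ≤ L` are bounded by `L`. [cite: GreenTao2010, (1.1)] -/
theorem abs_coeff_le_of_affLinSize {d t : ℕ} {Ψ : Fin t → AffLinForm d} {N : ℝ} {L : ℕ} (h : affLinSize Ψ N ≤ L)
    (i : Fin t) (j : Fin d) : |(Ψ i).coeff j| ≤ (L : ℤ) := by
  have h1 : |((Ψ i).coeff j : ℝ)| ≤ ∑ i, ∑ j, |((Ψ i).coeff j : ℝ)| := by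
    refine le_trans ?_ (Finset.single_le_sum (f := fun i => ∑ j, |((Ψ i).coeff j : ℝ)|) (fun i _ => by positivity) (mem_univ i))
    exact Finset.single_le_sum (f := fun j => |((Ψ i).coeff j : ℝ)|) (fun j _ => abs_nonneg _) (mem_univ j)
  have h2 : ∑ i, ∑ j, |((Ψ i).coeff j : ℝ)| ≤ affLinSize Ψ N := by
    unfold affLinSize
    exact le_add_of_nonneg_right (sum_nonneg fun i _ => abs_nonneg _)
  have : |((Ψ i).coeff j : ℝ)| ≤ L := h1.trans (h2.trans h)
  exact_mod_cast this

/-- `Λ_{χ,R,2}(y) = Λ_{χ,R}(y)² / log R`. [cite: GreenTao2010, App. D (definition of `Λ_{χ,R,a}`)] -/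
theorem truncDivisorSum_two_eq (χ : ℝ → ℝ) {R : ℝ} (hR : Real.log R ≠ 0) (y : ℤ) :
    truncDivisorSum χ R 2 y = (Real.log R)⁻¹ * smoothDivisorSum χ R y ^ 2 := by
  simp only [smoothDivisorSum, truncDivisorSum]
  field_simp

/-- `R^{10m} ≤ ⌊√N⌋ + 1` for `R = N^γ`, `10 m γ ≤ 1/2`, `N ≥ 1`. [folklore] -/
theorem rpow_pow_le_sqrt_succ {N : ℕ} (hN : 1 ≤ N) {γ : ℝ} {m : ℕ} (hm : 10 * m * γ ≤ 1 / 2) :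
    ((N : ℝ) ^ γ) ^ (10 * m) ≤ ((Nat.sqrt N + 1 : ℕ) : ℝ) := by
  have hN1 : (1 : ℝ) ≤ N := by exact_mod_cast hN
  rw [← Real.rpow_natCast, ← Real.rpow_mul (by linarith)]
  calc (N : ℝ) ^ (γ * (10 * m : ℕ)) ≤ (N : ℝ) ^ (1 / 2 : ℝ) :=
        Real.rpow_le_rpow_of_exponent_le hN1 (by push_cast; linarith)
    _ = Real.sqrt N := (Real.sqrt_eq_rpow _).symm
    _ ≤ ((Nat.sqrt N + 1 : ℕ) : ℝ) := by push_cast; exact Real.real_sqrt_lt_nat_sqrt_succ.le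

/-- The boundary term: `6(n+1)(2(N/ρ+2)+6)^n ρ^{n+1} ≤ 6(n+1)(22N)^n ρ` for `1 ≤ ρ ≤ 2N`. [folklore] -/
theorem boundary_mass_le {n N ρ : ℕ} (hρ : 1 ≤ ρ) (hρN : (ρ : ℝ) ≤ 2 * N) :
    6 * (n + 1 : ℝ) * (2 * ((N / ρ + 2 : ℕ) : ℝ) + 6) ^ n * (ρ : ℝ) ^ (n + 1) ≤
      6 * (n + 1 : ℝ) * (22 * N : ℝ) ^ n * ρ := by
  have hρ0 : (0 : ℝ) < ρ := by exact_mod_cast hρ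
  have hdiv : ((N / ρ : ℕ) : ℝ) * ρ ≤ N := by exact_mod_cast Nat.div_mul_le_self N ρ
  have h1 : (2 * ((N / ρ + 2 : ℕ) : ℝ) + 6) * ρ ≤ 22 * N := by
    push_cast
    nlinarith
  have h2 : (2 * ((N / ρ + 2 : ℕ) : ℝ) + 6) ^ n * (ρ : ℝ) ^ (n + 1) = ((2 * ((N / ρ + 2 : ℕ) : ℝ) + 6) * ρ) ^ n * ρ := by
    rw [mul_pow, pow_succ]; ring
  rw [mul_assoc, h2, ← mul_assoc]
  gcongr

end Prelim


/-! ### Assembly of the display (D.8) -/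

section Assembly

open Literature.NumberTheory.Sieve.CFZ Literature.NumberTheory.Sieve.GreenTao2008

/-- The conclusion of `box_estimate` with thresholds `K₁`, `w₀`. [cite: ConlonFoxZhao2014, Proposition 8.3] -/
def BoxConclusion (χ : ℝ → ℝ) (m n C₀ : ℕ) (ε K₁ : ℝ) (w₀ : ℕ) : Prop :=
  ∀ R : ℝ, 0 < R → K₁ ≤ Real.log R →
      ∀ w : ℕ, w₀ ≤ w → (w : ℝ) ≤ Real.log R ^ (1 / 8 : ℝ) →
      ∀ L : Fin m → Fin (n + 1) → ℤ, (∀ i j, |L i j| ≤ C₀) → (∀ i, L i ≠ 0) →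
        (∀ i i', i ≠ i' → ∀ c : ℚ, (fun j => (L i j : ℚ)) ≠ c • fun j => (L i' j : ℚ)) →
      ∀ (b : Fin m → ℤ) (a : Fin (n + 1) → ℤ) (ℓ : Fin (n + 1) → ℕ), (∀ j, R ^ (10 * m) ≤ ℓ j) →
        |(𝔼 x ∈ Fintype.piFinset (fun j => Ico (a j) (a j + ℓ j)),
            ∏ i, smoothDivisorSum χ R (primorial w * (∑ j, L i j * x j + b i) + 1) ^ 2) /
            (cChi χ * (primorial w : ℝ) * Real.log R / Nat.totient (primorial w)) ^ m - 1| ≤ ε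

/-- Larger thresholds are still thresholds. [folklore] -/
theorem BoxConclusion.mono {χ : ℝ → ℝ} {m n C₀ : ℕ} {ε K₁ K₁' : ℝ} {w₀ w₀' : ℕ} (h : BoxConclusion χ m n C₀ ε K₁ w₀)
    (hK : K₁ ≤ K₁') (hw : w₀ ≤ w₀') : BoxConclusion χ m n C₀ ε K₁' w₀' :=
  fun R hR hKR w hw' hwK => h R hR (hK.trans hKR) w (hw.trans hw') hwK

/-- `box_estimate`, uniformly over `m, n ≤ D` (finitely many thresholds). [cite: ConlonFoxZhao2014, Proposition 8.3] -/
theorem exists_uniform_thresholds {χ : ℝ → ℝ} (hs : ContDiff ℝ (⊤ : ℕ∞) χ) (hsupp : ∀ x, 1 ≤ |x| → χ x = 0)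
    (hχ1 : ∀ x, |χ x| ≤ 1) (hcχ : 0 < cChi χ) (D C₀ : ℕ) {ε : ℝ} (hε : 0 < ε) :
    ∃ K₁ : ℝ, 1 ≤ K₁ ∧ ∃ w₀ : ℕ, ∀ m n : ℕ, 1 ≤ m → m ≤ D → n ≤ D → BoxConclusion χ m n C₀ ε K₁ w₀ := by
  have h : ∀ m n : ℕ, ∃ K₁ : ℝ, 1 ≤ K₁ ∧ ∃ w₀ : ℕ, 1 ≤ m → BoxConclusion χ m n C₀ ε K₁ w₀ := by
    intro m n
    rcases Nat.eq_zero_or_pos m with rfl | hm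
    · exact ⟨1, le_rfl, 0, fun h => absurd h (by norm_num)⟩
    · obtain ⟨K₁, hK₁, w₀, hbox⟩ := box_estimate hs hsupp hχ1 hcχ m n C₀ hm hε
      exact ⟨K₁, hK₁, w₀, fun _ => hbox⟩
  choose K₁f hK₁f w₀f hbox using h
  refine ⟨∑ m ∈ range (D + 1), ∑ n ∈ range (D + 1), K₁f m n, ?_, ∑ m ∈ range (D + 1), ∑ n ∈ range (D + 1), w₀f m n,
    fun m n hm hmD hnD => ?_⟩
  · calc (1 : ℝ) ≤ K₁f 0 0 := hK₁f 0 0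
      _ ≤ ∑ n ∈ range (D + 1), K₁f 0 n :=
          single_le_sum (f := fun n => K₁f 0 n) (fun n _ => zero_le_one.trans (hK₁f 0 n)) (mem_range.2 (Nat.succ_pos D))
      _ ≤ ∑ m ∈ range (D + 1), ∑ n ∈ range (D + 1), K₁f m n :=
          single_le_sum (f := fun m => ∑ n ∈ range (D + 1), K₁f m n)
            (fun m _ => sum_nonneg fun n _ => zero_le_one.trans (hK₁f m n)) (mem_range.2 (Nat.succ_pos D))
  · refine (hbox m n hm).mono ?_ ?_
    · calc K₁f m n ≤ ∑ n' ∈ range (D + 1), K₁f m n' :=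
            single_le_sum (f := fun n' => K₁f m n') (fun n' _ => zero_le_one.trans (hK₁f m n')) (mem_range.2 (by omega))
        _ ≤ ∑ m' ∈ range (D + 1), ∑ n' ∈ range (D + 1), K₁f m' n' :=
            single_le_sum (f := fun m' => ∑ n' ∈ range (D + 1), K₁f m' n')
              (fun m' _ => sum_nonneg fun n' _ => zero_le_one.trans (hK₁f m' n')) (mem_range.2 (by omega))
    · calc w₀f m n ≤ ∑ n' ∈ range (D + 1), w₀f m n' :=
            single_le_sum (f := fun n' => w₀f m n') (fun n' _ => Nat.zero_le _) (mem_range.2 (by omega))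
        _ ≤ ∑ m' ∈ range (D + 1), ∑ n' ∈ range (D + 1), w₀f m' n' :=
            single_le_sum (f := fun m' => ∑ n' ∈ range (D + 1), w₀f m' n') (fun m' _ => Nat.zero_le _) (mem_range.2 (by omega))

/-- **The mass of a full cell.** Under the conclusion of the engine on the cell `mρ + [0,ρ)^d` for
the shifted forms `W(ψ_i + k_i) + 1` (`k_i` the shift of `exists_shift` for the residue `b_i`),
`(1 - ε') ρ^d c_χ^m ≤ (φ(W)/W)^m ∑_{x ∈ cell} ∏_i Λ_{χ,R,2}(Wψ_i(x) + b_i) ≤ (1 + ε') ρ^d c_χ^m`.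
[cite: GreenTao2010, App. D, proof of Prop. 6.4 (derivation of (D.8) from Thm. D.3)] -/
theorem cell_mass {n m : ℕ} {χ : ℝ → ℝ} (hcχ : 0 < cChi χ) {R : ℝ} (hR : 1 < R) {w : ℕ}
    (Ψ : Fin m → AffLinForm (n + 1)) (b : Fin m → ℕ) (hb : ∀ i, Nat.Coprime (b i) (primorial w))
    (k : Fin m → ℤ) (hk : ∀ i, (midPrimorial w ⌊R⌋₊ : ℤ) ∣ (primorial w : ℤ) * k i + 1 - b i)
    {ρ : ℕ} (hρ : 1 ≤ ρ) (mI : Fin (n + 1) → ℤ) {ε' : ℝ}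
    (hE : |(𝔼 x ∈ Fintype.piFinset (fun j => Ico (mI j * ρ) (mI j * ρ + ρ)),
        ∏ i, smoothDivisorSum χ R (primorial w * (∑ j, (Ψ i).coeff j * x j + ((Ψ i).const + k i)) + 1) ^ 2) /
        (cChi χ * (primorial w : ℝ) * Real.log R / Nat.totient (primorial w)) ^ m - 1| ≤ ε') :
    (1 - ε') * ((ρ : ℝ) ^ (n + 1)) * cChi χ ^ m ≤
      ((Nat.totient (primorial w) : ℝ) / primorial w) ^ m *
        ∑ x ∈ cellPts ρ mI, ∏ i, truncDivisorSum χ R 2 ((primorial w : ℤ) * (Ψ i).eval x + b i) ∧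
    ((Nat.totient (primorial w) : ℝ) / primorial w) ^ m *
        ∑ x ∈ cellPts ρ mI, ∏ i, truncDivisorSum χ R 2 ((primorial w : ℤ) * (Ψ i).eval x + b i) ≤
      (1 + ε') * ((ρ : ℝ) ^ (n + 1)) * cChi χ ^ m := by
  have hlogR : 0 < Real.log R := Real.log_pos hR
  have hW : (0 : ℝ) < primorial w := by exact_mod_cast primorial_pos w
  have hφ : (0 : ℝ) < Nat.totient (primorial w) := by exact_mod_cast Nat.totient_pos.2 (primorial_pos w)
  set Dn := (cChi χ * (primorial w : ℝ) * Real.log R / Nat.totient (primorial w)) ^ m with hDn_def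
  have hDn : 0 < Dn := by positivity
  set Ex := 𝔼 x ∈ Fintype.piFinset (fun j => Ico (mI j * ρ) (mI j * ρ + ρ)),
        ∏ i, smoothDivisorSum χ R (primorial w * (∑ j, (Ψ i).coeff j * x j + ((Ψ i).const + k i)) + 1) ^ 2 with hEx_def
  -- the engine bounds: `(1-ε') Dn ≤ Ex ≤ (1+ε') Dn`
  have hEx : (1 - ε') * Dn ≤ Ex ∧ Ex ≤ (1 + ε') * Dn := by
    have h := abs_le.1 hE
    rw [div_sub_one hDn.ne', le_div_iff₀ hDn, div_le_iff₀ hDn] at h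
    constructor <;> nlinarith [h.1, h.2]
  -- the cell sum in terms of `Ex`
  have hpt : ∀ x : Fin (n + 1) → ℤ, ∏ i, truncDivisorSum χ R 2 ((primorial w : ℤ) * (Ψ i).eval x + b i) =
      (Real.log R)⁻¹ ^ m * ∏ i, smoothDivisorSum χ R (primorial w * (∑ j, (Ψ i).coeff j * x j + ((Ψ i).const + k i)) + 1) ^ 2 := by
    intro x
    rw [show (Real.log R)⁻¹ ^ m = ∏ _i : Fin m, (Real.log R)⁻¹ by simp, ← prod_mul_distrib]
    refine prod_congr rfl fun i _ => ?_
    rw [truncDivisorSum_shift χ R 2 (hb i) (hk i), truncDivisorSum_two_eq χ hlogR.ne']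
    congr 3
    simp only [AffLinForm.eval]
    ring
  have hsum : ∑ x ∈ cellPts ρ mI, ∏ i, truncDivisorSum χ R 2 ((primorial w : ℤ) * (Ψ i).eval x + b i) =
      (Real.log R)⁻¹ ^ m * ((ρ : ℝ) ^ (n + 1) * Ex) := by
    rw [sum_congr rfl fun x _ => hpt x, ← mul_sum]
    congr 1
    rw [hEx_def, Finset.expect_eq_sum_div_card]
    unfold cellPts
    rw [show (Fintype.piFinset fun e => Ico (mI e * (ρ : ℤ)) (mI e * ρ + ρ)) = cellPts ρ mI from rfl, card_cellPts]
    push_cast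
    have : (0 : ℝ) < (ρ : ℝ) ^ (n + 1) := by positivity
    field_simp
  have hnorm : ((Nat.totient (primorial w) : ℝ) / primorial w) ^ m * ((Real.log R)⁻¹ ^ m * Dn) = cChi χ ^ m := by
    rw [hDn_def, ← mul_pow, ← mul_pow]
    congr 1
    field_simp
  rw [hsum]
  have hφW : 0 ≤ ((Nat.totient (primorial w) : ℝ) / primorial w) ^ m * (Real.log R)⁻¹ ^ m * (ρ : ℝ) ^ (n + 1) := by positivity
  constructor
  · calc (1 - ε') * (ρ : ℝ) ^ (n + 1) * cChi χ ^ m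
        = ((Nat.totient (primorial w) : ℝ) / primorial w) ^ m * (Real.log R)⁻¹ ^ m * (ρ : ℝ) ^ (n + 1) * ((1 - ε') * Dn) := by
          rw [← hnorm]; ring
      _ ≤ ((Nat.totient (primorial w) : ℝ) / primorial w) ^ m * (Real.log R)⁻¹ ^ m * (ρ : ℝ) ^ (n + 1) * Ex :=
          mul_le_mul_of_nonneg_left hEx.1 hφW
      _ = _ := by ring
  · calc ((Nat.totient (primorial w) : ℝ) / primorial w) ^ m * ((Real.log R)⁻¹ ^ m * ((ρ : ℝ) ^ (n + 1) * Ex))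
        = ((Nat.totient (primorial w) : ℝ) / primorial w) ^ m * (Real.log R)⁻¹ ^ m * (ρ : ℝ) ^ (n + 1) * Ex := by ring
      _ ≤ ((Nat.totient (primorial w) : ℝ) / primorial w) ^ m * (Real.log R)⁻¹ ^ m * (ρ : ℝ) ^ (n + 1) * ((1 + ε') * Dn) :=
          mul_le_mul_of_nonneg_left hEx.2 hφW
      _ = (1 + ε') * (ρ : ℝ) ^ (n + 1) * cChi χ ^ m := by rw [← hnorm]; ring

end Assembly


section Main

open Literature.NumberTheory.Sieve.CFZ Literature.NumberTheory.Sieve.GreenTao2008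

set_option maxHeartbeats 400000 in
open Classical in
/-- **The display (D.8) for cutoffs with `|χ| ≤ 1`.** The body of
`GreenTao2010_envelopingSieve_linearForms` for a smooth `χ` supported in `[-1,1]` with `|χ| ≤ 1`:
degenerate cutoffs (`c_χ = 0`) give `0 = 0`; otherwise cut `K ∩ ℤ^d` into cubes of side
`ρ = ⌊√N⌋ + 1 ≥ R^{10m}` (`γ ≤ 1/(20D+20)`), apply the engine on the full cubes after the residue
trick, bound the boundary cubes by non-negativity and `card_boundaryCells_le`, and compare the
number of full cubes with `vol(K)` through the lattice point count of App. A.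
[cite: GreenTao2010, App. D, proof of Prop. 6.4 (display (D.8) from Thm. D.3)]
[cite: ConlonFoxZhao2014, Proposition 8.3] -/
theorem linearForms_of_abs_le_one (D L : ℕ) {χ : ℝ → ℝ} (hχ : IsSmoothCompactCutoff χ) (hχ1 : ∀ x, |χ x| ≤ 1) :
    ∃ γ₀ : ℝ, 0 < γ₀ ∧ ∀ γ : ℝ, 0 < γ → γ ≤ γ₀ → ∀ ε : ℝ, 0 < ε → ∃ w₀ N₀ : ℕ,
      ∀ N : ℕ, N₀ ≤ N → ∀ w : ℕ, w₀ ≤ w → (w : ℝ) ≤ Real.log (Real.log N) / 2 →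
      ∀ (d m : ℕ), 1 ≤ d → d ≤ D → 1 ≤ m → m ≤ D →
      ∀ b : Fin m → ℕ, (∀ j, 1 ≤ b j ∧ b j ≤ primorial w ∧ Nat.Coprime (b j) (primorial w)) →
      ∀ Ψ : Fin m → AffLinForm d, IsNondegenerateSystem Ψ → IsFiniteComplexitySystem Ψ →
        affLinSize Ψ N ≤ L →
      ∀ K : Set (Fin d → ℝ), Convex ℝ K → K ⊆ realBox d N →
        (∀ x ∈ K, ∀ j, |(Ψ j).realEval x| ≤ N) →
        |((Nat.totient (primorial w) : ℝ) / primorial w) ^ m *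
            ∑ n ∈ (latticeBox d N).filter (fun n => realPoint n ∈ K),
              ∏ j, truncDivisorSum χ ((N : ℝ) ^ γ) 2 ((primorial w : ℤ) * (Ψ j).eval n + b j) -
          cChi χ ^ m * (volume K).toReal| ≤ ε * (N : ℝ) ^ d := by
  by_cases hc : 0 < cChi χ
  swap
  · -- degenerate cutoffs: everything vanishes
    have hc0 : cChi χ = 0 := le_antisymm (not_lt.1 hc) (cChi_nonneg χ)
    refine ⟨1, one_pos, fun γ hγ _ ε hε => ⟨0, 1, fun N hN w _ _ d m _ _ hm _ b _ Ψ _ _ _ K _ _ _ => ?_⟩⟩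
    have hR : (1 : ℝ) ≤ (N : ℝ) ^ γ := Real.one_le_rpow (by exact_mod_cast hN) hγ.le
    have h0 : ∀ nn : Fin d → ℤ, ∏ j, truncDivisorSum χ ((N : ℝ) ^ γ) 2 ((primorial w : ℤ) * (Ψ j).eval nn + b j) = 0 :=
      fun nn => Finset.prod_eq_zero (mem_univ ⟨0, hm⟩) (truncDivisorSum_eq_zero_of_cChi_eq_zero hχ hc0 hR (by norm_num) _)
    simp only [h0, sum_const_zero, mul_zero, hc0, zero_pow (by omega : m ≠ 0), zero_mul, sub_zero, abs_zero]
    positivity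
  -- the main case `c_χ > 0`
  have hs : ContDiff ℝ (⊤ : ℕ∞) χ := hχ.contDiff
  have hsupp : ∀ x, 1 ≤ |x| → χ x = 0 := hχ.eq_zero_of_one_le_abs
  set c := cChi χ with hc_def
  set Cc := (max 1 c) ^ D with hCc_def
  have hCc1 : 1 ≤ Cc := one_le_pow₀ (le_max_left _ _)
  have hcm : ∀ m ≤ D, c ^ m ≤ Cc := fun m hm =>
    (pow_le_pow_left₀ hc.le (le_max_right 1 c) m).trans (pow_le_pow_right₀ (le_max_left _ _) hm)
  refine ⟨1 / (20 * D + 20), by positivity, fun γ hγ hγ₀ ε hε => ?_⟩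
  -- the accuracy `ε'` demanded from the engine
  set ε' : ℝ := min (1 / 2) (ε / (4 * 2 ^ D * Cc)) with hε'_def
  have hε'0 : 0 < ε' := lt_min (by norm_num) (by positivity)
  have hε'1 : ε' ≤ 1 / 2 := min_le_left _ _
  have hε'b : ε' * (4 * 2 ^ D * Cc) ≤ ε := by
    have := min_le_right (1 / 2) (ε / (4 * 2 ^ D * Cc))
    rwa [← hε'_def, le_div_iff₀ (by positivity)] at this
  obtain ⟨K₁, hK₁, w₀, hbox⟩ := exists_uniform_thresholds hs hsupp hχ1 hc D L hε'0
  obtain ⟨N₁, hN₁⟩ := exists_loglog_le hγ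
  set Cj : ℝ := 26 * Cc * (D + 1) * 22 ^ D with hCj_def
  have hCj0 : 0 < Cj := by positivity
  refine ⟨w₀, max (max 1 N₁) (max ⌈Real.exp (K₁ / γ)⌉₊ ⌈(2 * Cj / ε) ^ 2⌉₊), ?_⟩
  intro N hN w hw hwlog d m hd hdD hm hmD b hb Ψ hnd hfc hΨL K hK hKN _
  obtain ⟨n, rfl⟩ : ∃ n, d = n + 1 := ⟨d - 1, by omega⟩
  -- unpacking `N ≥ N₀`
  have hN1 : 1 ≤ N := le_trans ((le_max_left _ _).trans (le_max_left _ _)) hN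
  have hNN₁ : N₁ ≤ N := le_trans ((le_max_right _ _).trans (le_max_left _ _)) hN
  have hNK : ⌈Real.exp (K₁ / γ)⌉₊ ≤ N := le_trans ((le_max_left _ _).trans (le_max_right _ _)) hN
  have hNC : ⌈(2 * Cj / ε) ^ 2⌉₊ ≤ N := le_trans ((le_max_right _ _).trans (le_max_right _ _)) hN
  have hN0 : (0 : ℝ) < N := by exact_mod_cast hN1
  have hN1' : (1 : ℝ) ≤ N := by exact_mod_cast hN1
  -- the level `R = N^γ`
  set R : ℝ := (N : ℝ) ^ γ with hR_def
  have hR0 : 0 < R := Real.rpow_pos_of_pos hN0 γ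
  have hlogR : Real.log R = γ * Real.log N := Real.log_rpow hN0 γ
  have hK₁R : K₁ ≤ Real.log R := by rw [hlogR]; exact le_mul_log_of_le hγ hNK
  have hR1 : 1 < R := by
    by_contra h
    have := Real.log_nonpos hR0.le (not_lt.1 h)
    linarith
  have hwK : (w : ℝ) ≤ Real.log R ^ (1 / 8 : ℝ) := by rw [hlogR]; exact hwlog.trans (hN₁ N hNN₁)
  -- the system in the format of the engine
  set Lm : Fin m → Fin (n + 1) → ℤ := fun i j => (Ψ i).coeff j with hLm_def
  have hLC : ∀ i j, |Lm i j| ≤ (L : ℤ) := fun i j => abs_coeff_le_of_affLinSize hΨL i j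
  have hL0 : ∀ i, Lm i ≠ 0 := fun i => hnd.1 i
  have hLp : ∀ i i', i ≠ i' → ∀ cq : ℚ, (fun j => (Lm i j : ℚ)) ≠ cq • fun j => (Lm i' j : ℚ) :=
    fun i i' hii' cq => not_rat_proportional hfc i i' hii' cq
  -- the shifts of the residue trick
  have hk : ∀ i, ∃ k : ℤ, (midPrimorial w ⌊R⌋₊ : ℤ) ∣ (primorial w : ℤ) * k + 1 - b i :=
    fun i => exists_shift w ⌊R⌋₊ (b i)
  choose k hk using hk
  -- the mesh `ρ = ⌊√N⌋ + 1`
  set ρ : ℕ := Nat.sqrt N + 1 with hρ_def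
  have hρ1 : 1 ≤ ρ := Nat.succ_pos _
  have hρN : (ρ : ℝ) ≤ 2 * N := by
    have h1 : (Nat.sqrt N : ℝ) ≤ N := by exact_mod_cast Nat.sqrt_le_self N
    rw [hρ_def]; push_cast; linarith
  have hρsq : (ρ : ℝ) ≤ 2 * Real.sqrt N := by
    have h1 : (Nat.sqrt N : ℝ) ≤ Real.sqrt N := Real.nat_sqrt_le_real_sqrt
    have h2 : 1 ≤ Real.sqrt N := by
      rw [show (1 : ℝ) = Real.sqrt 1 by simp]; exact Real.sqrt_le_sqrt hN1'
    rw [hρ_def]; push_cast; linarith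
  have hmγ : 10 * (m : ℝ) * γ ≤ 1 / 2 := by
    have hmD' : (m : ℝ) ≤ D := by exact_mod_cast hmD
    have h1 : 10 * (m : ℝ) * γ ≤ 10 * D * (1 / (20 * D + 20)) := by gcongr
    refine h1.trans ?_
    rw [mul_one_div, div_le_iff₀ (by positivity)]
    nlinarith
  have hℓ : R ^ (10 * m) ≤ (ρ : ℝ) := rpow_pow_le_sqrt_succ hN1 hmγ
  -- the engine on each cell
  have hcell : ∀ mI : Fin (n + 1) → ℤ,
      (1 - ε') * ((ρ : ℝ) ^ (n + 1)) * c ^ m ≤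
        ((Nat.totient (primorial w) : ℝ) / primorial w) ^ m *
          ∑ x ∈ cellPts ρ mI, ∏ i, truncDivisorSum χ R 2 ((primorial w : ℤ) * (Ψ i).eval x + b i) ∧
      ((Nat.totient (primorial w) : ℝ) / primorial w) ^ m *
          ∑ x ∈ cellPts ρ mI, ∏ i, truncDivisorSum χ R 2 ((primorial w : ℤ) * (Ψ i).eval x + b i) ≤
        (1 + ε') * ((ρ : ℝ) ^ (n + 1)) * c ^ m := fun mI =>
    cell_mass hc hR1 Ψ b (fun i => (hb i).2.2) k hk hρ1 mI
      (hbox m n hm hmD (by omega) R hR0 hK₁R w hw hwK Lm hLC hL0 hLp (fun i => (Ψ i).const + k i)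
        (fun j => mI j * ρ) (fun _ => ρ) (fun _ => hℓ))
  -- the normalised non-negative weight
  set F : (Fin (n + 1) → ℤ) → ℝ := fun x => ((Nat.totient (primorial w) : ℝ) / primorial w) ^ m *
      ∏ i, truncDivisorSum χ R 2 ((primorial w : ℤ) * (Ψ i).eval x + b i) with hF_def
  have hF : ∀ x, 0 ≤ F x := fun x => mul_nonneg (by positivity)
    (prod_nonneg fun i _ => mul_nonneg (Real.log_nonneg hR1.le) (sq_nonneg _))
  have hFsum : ∀ s : Finset (Fin (n + 1) → ℤ), ∑ x ∈ s, F x = ((Nat.totient (primorial w) : ℝ) / primorial w) ^ m *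
      ∑ x ∈ s, ∏ i, truncDivisorSum χ R 2 ((primorial w : ℤ) * (Ψ i).eval x + b i) := fun s => by
    rw [hF_def, ← mul_sum]
  obtain ⟨hS1, hS2, hC1, hC2⟩ := cell_sandwich hρ1 hKN F hF
  have hμ0 : 0 ≤ (ρ : ℝ) ^ (n + 1) := by positivity
  -- mass bounds on the good and bad cells
  have hgood_lo : (1 - ε') * c ^ m * (#(goodCells ρ N K) * (ρ : ℝ) ^ (n + 1)) ≤
      ∑ mI ∈ goodCells ρ N K, ∑ x ∈ cellPts ρ mI, F x := by
    have h := Finset.card_nsmul_le_sum (goodCells ρ N K) (fun mI => ∑ x ∈ cellPts ρ mI, F x)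
      ((1 - ε') * (ρ : ℝ) ^ (n + 1) * c ^ m) (fun mI _ => by rw [hFsum]; exact (hcell mI).1)
    rw [nsmul_eq_mul] at h
    linarith
  have hcells_hi : ∀ T : Finset (Fin (n + 1) → ℤ), ∑ mI ∈ T, ∑ x ∈ cellPts ρ mI, F x ≤
      #T * ((1 + ε') * (ρ : ℝ) ^ (n + 1) * c ^ m) := by
    intro T
    have h := Finset.sum_le_card_nsmul T (fun mI => ∑ x ∈ cellPts ρ mI, F x) ((1 + ε') * (ρ : ℝ) ^ (n + 1) * c ^ m)
      (fun mI _ => by rw [hFsum]; exact (hcell mI).2)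
    rwa [nsmul_eq_mul] at h
  have hS1' : (1 - ε') * c ^ m * (#(goodCells ρ N K) * (ρ : ℝ) ^ (n + 1)) ≤
      ∑ x ∈ (latticeBox (n + 1) N).filter (fun x => realPoint x ∈ K), F x := hgood_lo.trans hS1
  have hS2' : ∑ x ∈ (latticeBox (n + 1) N).filter (fun x => realPoint x ∈ K), F x ≤
      (1 + ε') * c ^ m * ((#(goodCells ρ N K) + #(badCells ρ N K)) * (ρ : ℝ) ^ (n + 1)) := by
    refine hS2.trans ?_
    have h1 := hcells_hi (goodCells ρ N K)
    have h2 := hcells_hi (badCells ρ N K)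
    linarith
  -- the lattice point count and the sandwich
  have hCV := LatticePointsConvexBody.abs_card_sub_volume_le n hN1 K hK hKN
  have hfinal := abs_sub_le_of_sandwich (pow_nonneg hc.le m) hε'0.le (by linarith) hμ0 (Nat.cast_nonneg _)
    hS1' hS2' hC1 hC2 hCV
  -- the boundary cells
  have hBμ : (#(badCells ρ N K) : ℝ) * (ρ : ℝ) ^ (n + 1) ≤ 6 * (n + 1 : ℝ) * (22 * N : ℝ) ^ n * ρ := by
    calc (#(badCells ρ N K) : ℝ) * (ρ : ℝ) ^ (n + 1)
        ≤ 6 * (n + 1) * (2 * ((N / ρ + 2 : ℕ) : ℝ) + 6) ^ n * (ρ : ℝ) ^ (n + 1) := by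
          gcongr; exact card_badCells_le hρ1 hK hKN
      _ ≤ _ := boundary_mass_le hρ1 hρN
  -- numerics
  have hsqrt1 : 1 ≤ Real.sqrt N := by
    rw [show (1 : ℝ) = Real.sqrt 1 by simp]; exact Real.sqrt_le_sqrt hN1'
  have hnD : (n : ℝ) + 1 ≤ D := by exact_mod_cast hdD
  have h4n : (4 : ℝ) ^ n ≤ 22 ^ D :=
    (pow_le_pow_left₀ (by norm_num) (by norm_num) n).trans (pow_le_pow_right₀ (by norm_num) (by omega))
  have h22n : (22 : ℝ) ^ n ≤ 22 ^ D := pow_le_pow_right₀ (by norm_num) (by omega)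
  have hjunk : ((n + 1) * 4 ^ n) * (N : ℝ) ^ n + (#(badCells ρ N K) : ℝ) * (ρ : ℝ) ^ (n + 1) ≤
      13 * (D + 1) * 22 ^ D * (N : ℝ) ^ n * Real.sqrt N := by
    have h1 : ((n + 1) * 4 ^ n) * (N : ℝ) ^ n ≤ (D + 1) * 22 ^ D * (N : ℝ) ^ n * Real.sqrt N := by
      calc ((n + 1) * 4 ^ n) * (N : ℝ) ^ n ≤ ((D + 1) * 22 ^ D) * (N : ℝ) ^ n * 1 := by rw [mul_one]; gcongr; linarith
        _ ≤ (D + 1) * 22 ^ D * (N : ℝ) ^ n * Real.sqrt N := by gcongr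
    have h2 : (#(badCells ρ N K) : ℝ) * (ρ : ℝ) ^ (n + 1) ≤ 12 * ((D + 1) * 22 ^ D * (N : ℝ) ^ n * Real.sqrt N) := by
      calc (#(badCells ρ N K) : ℝ) * (ρ : ℝ) ^ (n + 1) ≤ 6 * (n + 1 : ℝ) * (22 * N : ℝ) ^ n * ρ := hBμ
        _ ≤ 6 * (D + 1 : ℝ) * (22 ^ D * (N : ℝ) ^ n) * (2 * Real.sqrt N) := by
            rw [mul_pow]; gcongr; linarith
        _ = 12 * ((D + 1) * 22 ^ D * (N : ℝ) ^ n * Real.sqrt N) := by ring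
    linarith
  have hV : (volume K).toReal ≤ 2 ^ D * (N : ℝ) ^ (n + 1) := by
    calc (volume K).toReal ≤ (2 * N : ℝ) ^ (n + 1) := volume_toReal_le_of_subset_realBox hKN
      _ = 2 ^ (n + 1) * (N : ℝ) ^ (n + 1) := by rw [mul_pow]
      _ ≤ 2 ^ D * (N : ℝ) ^ (n + 1) :=
          mul_le_mul_of_nonneg_right (pow_le_pow_right₀ (by norm_num) (by omega)) (by positivity)
  have hsqrtN : 2 * Cj / ε ≤ Real.sqrt N := by
    refine Real.le_sqrt_of_sq_le ?_
    exact (Nat.le_ceil _).trans (by exact_mod_cast hNC)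
  have hterm1 : ε' * c ^ m * (volume K).toReal ≤ ε / 4 * (N : ℝ) ^ (n + 1) := by
    calc ε' * c ^ m * (volume K).toReal ≤ ε' * Cc * (2 ^ D * (N : ℝ) ^ (n + 1)) := by gcongr; exact hcm m hmD
      _ = (ε' * (4 * 2 ^ D * Cc)) / 4 * (N : ℝ) ^ (n + 1) := by ring
      _ ≤ ε / 4 * (N : ℝ) ^ (n + 1) := by gcongr
  have hterm2 : 2 * c ^ m * (((n + 1) * 4 ^ n) * (N : ℝ) ^ n + (#(badCells ρ N K) : ℝ) * (ρ : ℝ) ^ (n + 1)) ≤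
      ε / 2 * (N : ℝ) ^ (n + 1) := by
    calc 2 * c ^ m * (((n + 1) * 4 ^ n) * (N : ℝ) ^ n + (#(badCells ρ N K) : ℝ) * (ρ : ℝ) ^ (n + 1))
        ≤ 2 * Cc * (13 * (D + 1) * 22 ^ D * (N : ℝ) ^ n * Real.sqrt N) := by gcongr; exact hcm m hmD
      _ = Cj * Real.sqrt N * (N : ℝ) ^ n := by rw [hCj_def]; ring
      _ ≤ (ε / 2 * Real.sqrt N) * Real.sqrt N * (N : ℝ) ^ n := by
          gcongr
          rw [div_le_iff₀ hε] at hsqrtN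
          linarith
      _ = ε / 2 * (N : ℝ) ^ (n + 1) := by
          rw [mul_assoc (ε / 2), Real.mul_self_sqrt hN0.le, pow_succ]; ring
  -- conclusion
  rw [← hFsum]
  calc |∑ x ∈ (latticeBox (n + 1) N).filter (fun x => realPoint x ∈ K), F x - c ^ m * (volume K).toReal|
      ≤ ε' * c ^ m * (volume K).toReal +
        2 * c ^ m * (((n + 1) * 4 ^ n) * (N : ℝ) ^ n + (#(badCells ρ N K) : ℝ) * (ρ : ℝ) ^ (n + 1)) := hfinal
    _ ≤ ε / 4 * (N : ℝ) ^ (n + 1) + ε / 2 * (N : ℝ) ^ (n + 1) := add_le_add hterm1 hterm2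
    _ ≤ ε * (N : ℝ) ^ (n + 1) := by
        have : 0 ≤ ε * (N : ℝ) ^ (n + 1) := by positivity
        linarith

end Main


section Final

open Literature.NumberTheory.Sieve.GreenTao2008

/-- **Green–Tao 2010, App. D, display (D.8) — the linear forms estimate for the enveloping sieve,
PROVED** (the named fact `GreenTao2010_envelopingSieve_linearForms` of
`LinearEquationsInPrimesEnvelopingSieveFacts.lean` discharged): by scaling `χ = s χ₁` with
`|χ₁| ≤ 1` (`Λ_{χ,R,2} = s² Λ_{χ₁,R,2}`, `c_χ = s² c_{χ₁}`) this is `linearForms_of_abs_le_one`, i.e.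
the smooth Goldston–Yıldırım engine of the tree (Conlon–Fox–Zhao §9, `SmoothMajorant*`) after the
residue trick, on the cells of a cube decomposition of `K ∩ ℤ^d`.
[cite: GreenTao2010, App. D, proof of Prop. 6.4 (display (D.8)) and Thm. D.3]
[cite: ConlonFoxZhao2014, Proposition 8.3 and Section 9] -/
theorem _root_.Literature.NumberTheory.Sieve.GreenTao2010_envelopingSieve_linearForms_holds :
    GreenTao2010_envelopingSieve_linearForms := by
  classical
  intro D L χ hχ
  obtain ⟨s, hs1, hsχ⟩ := exists_bound_cutoff hχ
  have hs0 : 0 < s := by linarith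
  set χ₁ : ℝ → ℝ := fun x => s⁻¹ * χ x with hχ₁_def
  have hχ₁ : IsSmoothCompactCutoff χ₁ := isSmoothCompactCutoff_smul s⁻¹ hχ
  have hχ₁1 : ∀ x, |χ₁ x| ≤ 1 := fun x => by
    simp only [hχ₁_def, abs_mul, abs_inv, abs_of_pos hs0]
    rw [inv_mul_le_iff₀ hs0, mul_one]
    exact hsχ x
  have hχeq : (fun x => s * χ₁ x) = χ := by
    funext x
    simp only [hχ₁_def]
    rw [mul_inv_cancel_left₀ hs0.ne']
  have ht : ∀ (R : ℝ) (y : ℤ), truncDivisorSum χ R 2 y = s ^ 2 * truncDivisorSum χ₁ R 2 y := fun R y => by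
    have := truncDivisorSum_two_smul s χ₁ R y
    rwa [hχeq] at this
  have hcc : cChi χ = s ^ 2 * cChi χ₁ := by
    have := cChi_smul s χ₁
    rwa [hχeq] at this
  obtain ⟨γ₀, hγ₀, hmain⟩ := linearForms_of_abs_le_one D L hχ₁ hχ₁1
  refine ⟨γ₀, hγ₀, fun γ hγ hγγ₀ ε hε => ?_⟩
  obtain ⟨w₀, N₀, h⟩ := hmain γ hγ hγγ₀ (ε / s ^ (2 * D)) (by positivity)
  refine ⟨w₀, N₀, fun N hN w hw hwl d m hd hdD hm hmD b hb Ψ hnd hfc hΨ K hK hKN hΨK => ?_⟩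
  have key := h N hN w hw hwl d m hd hdD hm hmD b hb Ψ hnd hfc hΨ K hK hKN hΨK
  have hprod : ∀ nn : Fin d → ℤ, ∏ j, truncDivisorSum χ ((N : ℝ) ^ γ) 2 ((primorial w : ℤ) * (Ψ j).eval nn + b j) =
      (s ^ 2) ^ m * ∏ j, truncDivisorSum χ₁ ((N : ℝ) ^ γ) 2 ((primorial w : ℤ) * (Ψ j).eval nn + b j) := by
    intro nn
    rw [prod_congr rfl fun j _ => ht _ _, prod_mul_distrib, prod_const, card_univ, Fintype.card_fin]
  rw [sum_congr rfl fun nn _ => hprod nn, ← mul_sum, hcc, mul_pow]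
  have e : ((Nat.totient (primorial w) : ℝ) / primorial w) ^ m *
        ((s ^ 2) ^ m * ∑ nn ∈ (latticeBox d N).filter (fun nn => realPoint nn ∈ K),
          ∏ j, truncDivisorSum χ₁ ((N : ℝ) ^ γ) 2 ((primorial w : ℤ) * (Ψ j).eval nn + b j)) -
        (s ^ 2) ^ m * cChi χ₁ ^ m * (volume K).toReal =
      (s ^ 2) ^ m * (((Nat.totient (primorial w) : ℝ) / primorial w) ^ m *
        ∑ nn ∈ (latticeBox d N).filter (fun nn => realPoint nn ∈ K),
          ∏ j, truncDivisorSum χ₁ ((N : ℝ) ^ γ) 2 ((primorial w : ℤ) * (Ψ j).eval nn + b j) -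
        cChi χ₁ ^ m * (volume K).toReal) := by ring
  rw [e, abs_mul, abs_of_pos (by positivity)]
  have hsm : (s ^ 2) ^ m ≤ s ^ (2 * D) := by
    rw [← pow_mul]
    exact pow_le_pow_right₀ hs1 (by omega)
  have hsD : 0 < s ^ (2 * D) := by positivity
  calc (s ^ 2) ^ m * |((Nat.totient (primorial w) : ℝ) / primorial w) ^ m *
          ∑ nn ∈ (latticeBox d N).filter (fun nn => realPoint nn ∈ K),
            ∏ j, truncDivisorSum χ₁ ((N : ℝ) ^ γ) 2 ((primorial w : ℤ) * (Ψ j).eval nn + b j) -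
          cChi χ₁ ^ m * (volume K).toReal|
      ≤ s ^ (2 * D) * (ε / s ^ (2 * D) * (N : ℝ) ^ d) := mul_le_mul hsm key (abs_nonneg _) hsD.le
    _ = ε * (N : ℝ) ^ d := by field_simp

end Final

end EnvelopingSieveGY

end Literature.NumberTheory.Sieve
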